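import Literature.NumberTheory.LFunctions.VinogradovKorobovDirichlet
import Literature.NumberTheory.LFunctions.VinogradovKorobovInputs
import Literature.NumberTheory.LFunctions.DirichletLFunctionZeroFreeRegion
import Literature.NumberTheory.LFunctions.ZetaOneLineBounds
import HarnessLib

/-!
# The Vinogradov–Korobov zero-free region from Richert-type bounds (Landau–Titchmarsh deduction)

Topic `Literature/NumberTheory/LFunctions`.  Everything in this file is PROVED; it introduces no
named fact (the only `def`s are a parametrised hypothesis, `RichertBoundL A B`, and the named
constants of the proof).

**What is proved.**  The classical deduction "upper bound of Richert type near `σ = 1` ⟹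
zero-free region of Vinogradov–Korobov shape" (Titchmarsh, *The Theory of the Riemann
Zeta-Function*, 2nd ed., Theorem 3.10 — the general `θ(t), φ(t)` theorem, proved by Lemma α of §3.9 —
applied as in §6.19 there with Richert's bound (6.19.2), `θ(t) = (log log t/(100 log t))^{2/3}`,
`φ(t) = log log t`: "therefore give a region `σ ≥ 1 − A(log t)^{-2/3}(log log t)^{-1/3}` free of
zeros"; for Dirichlet `L`-functions Khale, arXiv:2210.06457, Appendix B, Theorem B.1, whose hypothesis
(2.4) is the Hurwitz-zeta form of the Richert bound), with INEXPLICIT constants: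

* `VKFromRichert.zeta_zeroFree_of_richertBound` — if `RichertBound A B`
  (`|ζ(σ + it)| ≤ A|t|^{B(1−σ)^{3/2}}(log|t|)^{2/3}`, `|t| ≥ 3`, `1/2 ≤ σ ≤ 1`; the tree's predicate of
  `VinogradovKorobovInputs.lean`, e.g. Ford's Theorem 1 `zeta_bound_ford` gives `(76.2, 4.45)`), then
  `∃ c > 0`, `ζ(σ + it) ≠ 0` for `|t| ≥ 21`, `σ ≥ 1 − c/((log|t|)^{2/3}(log log|t|)^{1/3})`;
  `zeta_zeroFree_of_zeta_bound_ford` (top level) is the corollary from Ford's Theorem 1 alone.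
* `VKFromRichert.vk_region_of_richert` = `hasVKZeroFreeRegion_of_richert` (top level) — if moreover
  `RichertBoundL A B` (the same bound, with the factor `q^{1−σ}(1 + log q)`, for the `L(s, χ)` of
  NON-principal characters; the shape delivered by `L(s, χ) = q^{-s}∑_a χ(a)ζ(s, a/q)` from the
  Hurwitz form), then `∃ c > 0, HasVKZeroFreeRegion c 21`, i.e. for all `q ≥ 3`, all `χ` mod `q`,
  `|t| ≥ 21`: `L(σ + it, χ) ≠ 0` for `σ ≥ 1 − c/(log q + (log|t|)^{2/3}(log log|t|)^{1/3})` — the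
  interface hypothesis of `VinogradovKorobovDirichlet.lean`, through which the twisted prime number
  theorem (`TwistedVonMangoldtSum.lean`) and its users (Matomäki–Radziwiłł–Tao (1.12),
  `TaoLogChowlaProofs.lean`; Lichtman's Lemma 4.5) are fed.

* All of this is proved for Richert-TYPE bounds with an arbitrary power `P ≥ 0` of `log|t|` in
  place of `2/3` (`RichertTypeBound A B P`, `RichertTypeBoundL A B P`;
  `vk_region_of_richertType`, `hasVKZeroFreeRegion_of_richertType`, `zeta_zeroFree_of_richertType`):
  only the logarithm of the bound enters the argument (Titchmarsh's `φ(t) ≍ log log t`), so the crude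
  dyadic consequence `P = 1` of Vinogradov's exponential-sum estimate already suffices.

So after this file the Vinogradov–Korobov input of that chain is reduced to the two Richert-type
bounds, i.e. to Vinogradov's estimate for the exponential sums `∑ (n + u)^{-it}` (Ford 2002,
Theorem 2 ⟹ Theorem 1 is `FordZetaBoundMain.lean` for `ζ`).

## The argument (Landau 1924 / Titchmarsh §3.9–3.10, run uniformly in `q`)

Let `ρ = β + iγ` be a zero, `|γ| ≥ 21`, `ℓ = log|γ| ≥ 3`, `λ = log ℓ ≥ 1`, `Y = ℓ^{2/3}λ^{1/3}`
(`VKFromRichert.Yv`), `ℒ = L_q + Y` with `L_q = log q` (or `0` for `ζ`), and suppose `L_q ≤ ℓ`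
(the `t`-dominant regime).  Put `R = λ/(16ℒ)` (`Rr`), `d = W⁻²/(16ℒ)` (`dd`, `W` the constant `Wc`
below) and apply Titchmarsh's Lemma α (`Literature.Analysis.Complex.titchmarsh_logDeriv_sub_sum_of_differentiableOn`,
packaged as `neg_re_logDeriv_le`) on the discs of radius `2R` about `1 + d + iγ` and
`1 + d + 2iγ`: there `|L|, |ζ| ≤ M = 2^{P+1}Aℓ^{P+3+B/10} + 42ℓ` (`norm_LFunction_le_on_disc`,
`norm_zeta_le_on_disc`: for `Re z ≤ 1` the Richert bound with `q^{1−σ'} ≤ e^{2R log q} ≤ ℓ^{1/8}`,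
`|t'|^{B(1−σ')^{3/2}} ≤ ℓ^{B/10}` as `3200R³ℓ² ≤ λ²`; for `Re z ≥ 1` the elementary
`|L(z, χ)| ≤ log q + log|t'| + 5`, `norm_LFunction_le_log`, and Titchmarsh's Theorem 3.5 for `ζ`),
while `|L(1 + d + it)| ≥ d/2`; hence with `E = 8(log(2M/d) + 1)/R ≪ ℒ`:
`−Re L'/L(1+d+iγ, χ) ≤ E − 1/(1 + d − β)`, `−Re L'/L(1+d+2iγ, χ²) ≤ E` (third function
`ζ(1+d+2iγ)` when `χ² = χ₀`), `−ζ'/ζ(1+d) ≤ 1/d + K₀`.  The `3-4-1` inequality (MV Lemma 11.2 /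
Lemma 6.5, `DirichletZFR.three_four_one(_quadratic)`, `ClassicalZFRData.three_four_one`) gives
`4/(d + η) ≤ 3/d + 3K₀ + 5E` (`η = 1 − β`), which is impossible for `η < d/8` because
`3K₀ + 5E ≤ W²ℒ < 5/(9d)` (`const_facts`, with `W = 3K₀ + 640(log(2^{P+1}A+42) + P + 3 + B/10 + 7)`).
Hence `1 − β ≥ d/8 = 1/(128 W² ℒ)` (`one_sub_re_ge_L`, `one_sub_re_ge_zeta`).  In the
`q`-dominant regime `log q > ℓ` the classical region (MV Theorem 11.3, `DirichletZFR.exists_zeroFree`)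
is already wider (`log q + log(|t| + 4) ≤ 3 log q`; `t ≠ 0` excludes the exceptional zero), and the
principal character reduces to `ζ` via `L(s, χ₀) = ζ(s)∏_{p ∣ q}(1 − p^{-s})`.  The final constant is
`c = min(1/(256 W²), c₁/4)`, `c₁` the constant of MV Theorem 11.3 in the tree.

## References

* E. C. Titchmarsh, *The Theory of the Riemann Zeta-Function*, 2nd ed. revised by D. R. Heath-Brown
  (1986), §3.9 Lemma α, Theorem 3.5, Theorem 3.10, §6.19 ((6.19.2) and the display following it).
  [Titchmarsh1986]
* T. Khale, *An explicit Vinogradov–Korobov zero-free region for Dirichlet L-functions*, Q. J. Math.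
  75 (2024) = arXiv:2210.06457, (1.4), (2.4), Appendix B (Theorem B.1, Corollary B.2). [Khale2024]
* H. L. Montgomery, R. C. Vaughan, *Multiplicative Number Theory I*, Lemma 6.5, Lemma 11.2,
  Theorem 11.3, §4.3 (4.23). [MontgomeryVaughan2007]
* K. Ford, *Vinogradov's integral and bounds for the Riemann zeta function*, Proc. LMS 85 (2002),
  Theorem 1. [Ford2002]

## Design notes

* Constants are explicit but not optimised; thresholds: `|t| ≥ 21 > e³` (so that `log log|t| ≥ 1`).
  The consumers (`VKDirichlet.…_of_vk`) accept any constant and any starting height.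
* `δ` is a token of the `LSeries.notation` scope, so the distance `σ₀ − 1` is called `d`.
-/

noncomputable section

open Complex Filter Topology Metric Set Finset
open scoped LSeries.notation ArithmeticFunction.vonMangoldt

namespace Literature.NumberTheory.LFunctions

/-- A **Richert-type bound for the Dirichlet `L`-functions of non-principal characters** with
constants `(A, B)`: for every `q ≥ 1`, every `χ ≠ χ₀` mod `q`, `|t| ≥ 3` and `1/2 ≤ σ ≤ 1`,
`|L(σ + it, χ)| ≤ A q^{1−σ} (1 + log q) |t|^{B(1−σ)^{3/2}} (log|t|)^{2/3}`.  This is the shape that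
the Hurwitz-zeta form of Ford's bound (Khale 2024, (2.4): `|ζ(s, u) − u^{-s}| ≤ A t^{B(1−σ)^{3/2}}
log^{2/3} t` for `0 < u ≤ 1`) gives through `L(s, χ) = q^{-s} ∑_{a ≤ q} χ(a) ζ(s, a/q)` and
`∑_{a ≤ q} a^{-σ} ≤ q^{1−σ}(1 + log q)`; a predicate in `(A, B)` (the companion of `RichertBound A B`
for `ζ`), not a named fact. [cite: Khale2024, (2.4)] -/
def RichertBoundL (A B : ℝ) : Prop :=
  ∀ (q : ℕ) [NeZero q] (χ : DirichletCharacter ℂ q), χ ≠ 1 → ∀ σ t : ℝ, 3 ≤ |t| → 1 / 2 ≤ σ →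
    σ ≤ 1 →
      ‖χ.LFunction (σ + t * I)‖ ≤ A * (q : ℝ) ^ (1 - σ) * (1 + Real.log q) *
        |t| ^ (B * (1 - σ) ^ (3 / 2 : ℝ)) * Real.log |t| ^ (2 / 3 : ℝ)

/-- A **Richert-type bound for `ζ` with an arbitrary power `P` of the logarithm**:
`|ζ(σ + it)| ≤ A|t|^{B(1−σ)^{3/2}}(log|t|)^P` for `|t| ≥ 3`, `1/2 ≤ σ ≤ 1`.  `RichertBound A B` is the
case `P = 2/3` (Richert 1967; Titchmarsh (6.19.2)); the Landau–Titchmarsh deduction below works for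
any fixed `P ≥ 0` (only `log` of the bound enters, through `φ(t) ≍ log log t` in Titchmarsh's
Theorem 3.10), and the crude dyadic use of Vinogradov's exponential-sum estimate yields `P = 1`.
A predicate in `(A, B, P)`, not a named fact. [cite: Titchmarsh1986, Theorem 3.10 and §6.19] -/
def RichertTypeBound (A B P : ℝ) : Prop :=
  ∀ σ t : ℝ, 3 ≤ |t| → 1 / 2 ≤ σ → σ ≤ 1 →
    ‖riemannZeta (σ + t * I)‖ ≤ A * |t| ^ (B * (1 - σ) ^ (3 / 2 : ℝ)) * Real.log |t| ^ P

/-- The same for the `L`-functions of non-principal characters, with the factor `q^{1−σ}(1 + log q)`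
of `RichertBoundL`: `|L(σ + it, χ)| ≤ A q^{1−σ}(1 + log q)|t|^{B(1−σ)^{3/2}}(log|t|)^P` (`χ ≠ χ₀` mod `q`,
`|t| ≥ 3`, `1/2 ≤ σ ≤ 1`).  A predicate in `(A, B, P)`. [cite: Khale2024, (2.4)] -/
def RichertTypeBoundL (A B P : ℝ) : Prop :=
  ∀ (q : ℕ) [NeZero q] (χ : DirichletCharacter ℂ q), χ ≠ 1 → ∀ σ t : ℝ, 3 ≤ |t| → 1 / 2 ≤ σ →
    σ ≤ 1 →
      ‖χ.LFunction (σ + t * I)‖ ≤ A * (q : ℝ) ^ (1 - σ) * (1 + Real.log q) *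
        |t| ^ (B * (1 - σ) ^ (3 / 2 : ℝ)) * Real.log |t| ^ P

/-- `RichertBound A B` is `RichertTypeBound A B (2/3)`. [folklore] -/
theorem richertTypeBound_of_richertBound {A B : ℝ} (h : RichertBound A B) :
    RichertTypeBound A B (2 / 3) := h

/-- `RichertBoundL A B` is `RichertTypeBoundL A B (2/3)`. [folklore] -/
theorem richertTypeBoundL_of_richertBoundL {A B : ℝ} (h : RichertBoundL A B) :
    RichertTypeBoundL A B (2 / 3) := h

namespace VKFromRichert

/-! ### Normalising the constants: `A ≥ 1`, `B ≥ 0` may be assumed -/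

/-- For `|t| ≥ 3`, `0 ≤ x`: the factor `|t|^{Bx} (log|t|)^{P}` is monotone in `B`. [folklore] -/
theorem rpow_factor_mono {t x B B' P : ℝ} (ht : 3 ≤ |t|) (hx : 0 ≤ x) (hB : B ≤ B') :
    |t| ^ (B * x) * Real.log |t| ^ P ≤ |t| ^ (B' * x) * Real.log |t| ^ P := by
  have ht1 : 1 ≤ |t| := by linarith
  have hlog : 0 ≤ Real.log |t| := Real.log_nonneg ht1
  exact mul_le_mul_of_nonneg_right (Real.rpow_le_rpow_of_exponent_le ht1 (by nlinarith))
    (Real.rpow_nonneg hlog _)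

/-- `RichertBound A B → RichertBound (max A 1) (max B 0)`. [folklore] -/
theorem richertBound_max {A B : ℝ} (h : RichertBound A B) : RichertBound (max A 1) (max B 0) := by
  intro σ t ht h1 h2
  refine (h σ t ht h1 h2).trans ?_
  have hx : 0 ≤ (1 - σ) ^ (3 / 2 : ℝ) := Real.rpow_nonneg (by linarith) _
  have hfac := rpow_factor_mono (B := B) (B' := max B 0) (P := 2 / 3) ht hx (le_max_left _ _)
  have hlog : 0 ≤ Real.log |t| := Real.log_nonneg (by linarith)
  have hb0 : 0 ≤ |t| ^ (B * (1 - σ) ^ (3 / 2 : ℝ)) * Real.log |t| ^ (2 / 3 : ℝ) :=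
    mul_nonneg (Real.rpow_nonneg (abs_nonneg t) _) (Real.rpow_nonneg hlog _)
  have hpos : 0 ≤ |t| ^ (max B 0 * (1 - σ) ^ (3 / 2 : ℝ)) * Real.log |t| ^ (2 / 3 : ℝ) :=
    mul_nonneg (Real.rpow_nonneg (abs_nonneg t) _) (Real.rpow_nonneg hlog _)
  calc A * |t| ^ (B * (1 - σ) ^ (3 / 2 : ℝ)) * Real.log |t| ^ (2 / 3 : ℝ)
      = A * (|t| ^ (B * (1 - σ) ^ (3 / 2 : ℝ)) * Real.log |t| ^ (2 / 3 : ℝ)) := by ring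
    _ ≤ max A 1 * (|t| ^ (max B 0 * (1 - σ) ^ (3 / 2 : ℝ)) * Real.log |t| ^ (2 / 3 : ℝ)) := by
        rcases le_or_gt 0 A with hA | hA
        · exact mul_le_mul (le_max_left _ _) hfac hb0 (le_trans hA (le_max_left _ _))
        · have h0 : A * (|t| ^ (B * (1 - σ) ^ (3 / 2 : ℝ)) * Real.log |t| ^ (2 / 3 : ℝ)) ≤ 0 :=
            mul_nonpos_of_nonpos_of_nonneg hA.le hb0
          exact h0.trans (mul_nonneg (le_trans zero_le_one (le_max_right _ _)) hpos)
    _ = _ := by ring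

/-- `RichertBoundL A B → RichertBoundL (max A 1) (max B 0)`. [folklore] -/
theorem richertBoundL_max {A B : ℝ} (h : RichertBoundL A B) :
    RichertBoundL (max A 1) (max B 0) := by
  intro q _ χ hχ σ t ht h1 h2
  refine (h q χ hχ σ t ht h1 h2).trans ?_
  have hx : 0 ≤ (1 - σ) ^ (3 / 2 : ℝ) := Real.rpow_nonneg (by linarith) _
  have hfac := rpow_factor_mono (B := B) (B' := max B 0) (P := 2 / 3) ht hx (le_max_left _ _)
  have hlog : 0 ≤ Real.log |t| := Real.log_nonneg (by linarith)
  have hq0 : (0 : ℝ) < q := by exact_mod_cast NeZero.pos q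
  have hq1 : (1 : ℝ) ≤ q := by exact_mod_cast NeZero.one_le
  have hlogq : 0 ≤ Real.log q := Real.log_nonneg hq1
  have hQ : 0 ≤ (q : ℝ) ^ (1 - σ) * (1 + Real.log q) := by positivity
  have hb0 : 0 ≤ |t| ^ (B * (1 - σ) ^ (3 / 2 : ℝ)) * Real.log |t| ^ (2 / 3 : ℝ) :=
    mul_nonneg (Real.rpow_nonneg (abs_nonneg t) _) (Real.rpow_nonneg hlog _)
  have hpos : 0 ≤ |t| ^ (max B 0 * (1 - σ) ^ (3 / 2 : ℝ)) * Real.log |t| ^ (2 / 3 : ℝ) :=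
    mul_nonneg (Real.rpow_nonneg (abs_nonneg t) _) (Real.rpow_nonneg hlog _)
  have hA1 : 0 ≤ max A 1 := le_trans zero_le_one (le_max_right _ _)
  calc A * (q : ℝ) ^ (1 - σ) * (1 + Real.log q) * |t| ^ (B * (1 - σ) ^ (3 / 2 : ℝ)) *
        Real.log |t| ^ (2 / 3 : ℝ)
      = A * ((q : ℝ) ^ (1 - σ) * (1 + Real.log q)) *
          (|t| ^ (B * (1 - σ) ^ (3 / 2 : ℝ)) * Real.log |t| ^ (2 / 3 : ℝ)) := by ring
    _ ≤ max A 1 * ((q : ℝ) ^ (1 - σ) * (1 + Real.log q)) *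
          (|t| ^ (max B 0 * (1 - σ) ^ (3 / 2 : ℝ)) * Real.log |t| ^ (2 / 3 : ℝ)) := by
        rcases le_or_gt 0 A with hA | hA
        · exact mul_le_mul (mul_le_mul_of_nonneg_right (le_max_left _ _) hQ) hfac
            hb0 (mul_nonneg hA1 hQ)
        · have h0 : A * ((q : ℝ) ^ (1 - σ) * (1 + Real.log q)) *
              (|t| ^ (B * (1 - σ) ^ (3 / 2 : ℝ)) * Real.log |t| ^ (2 / 3 : ℝ)) ≤ 0 := by
            have : A * ((q : ℝ) ^ (1 - σ) * (1 + Real.log q)) ≤ 0 :=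
              mul_nonpos_of_nonpos_of_nonneg hA.le hQ
            exact mul_nonpos_of_nonpos_of_nonneg this hb0
          exact h0.trans (mul_nonneg (mul_nonneg hA1 hQ) hpos)
    _ = _ := by ring

/-- `RichertTypeBound A B P → RichertTypeBound (max A 1) (max B 0) P`. [folklore] -/
theorem richertType_max {A B P : ℝ} (h : RichertTypeBound A B P) :
    RichertTypeBound (max A 1) (max B 0) P := by
  intro σ t ht h1 h2
  refine (h σ t ht h1 h2).trans ?_
  have hx : 0 ≤ (1 - σ) ^ (3 / 2 : ℝ) := Real.rpow_nonneg (by linarith) _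
  have hfac := rpow_factor_mono (B := B) (B' := max B 0) (P := P) ht hx (le_max_left _ _)
  have hlog : 0 ≤ Real.log |t| := Real.log_nonneg (by linarith)
  have hb0 : 0 ≤ |t| ^ (B * (1 - σ) ^ (3 / 2 : ℝ)) * Real.log |t| ^ P :=
    mul_nonneg (Real.rpow_nonneg (abs_nonneg t) _) (Real.rpow_nonneg hlog _)
  have hpos : 0 ≤ |t| ^ (max B 0 * (1 - σ) ^ (3 / 2 : ℝ)) * Real.log |t| ^ P :=
    mul_nonneg (Real.rpow_nonneg (abs_nonneg t) _) (Real.rpow_nonneg hlog _)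
  calc A * |t| ^ (B * (1 - σ) ^ (3 / 2 : ℝ)) * Real.log |t| ^ P
      = A * (|t| ^ (B * (1 - σ) ^ (3 / 2 : ℝ)) * Real.log |t| ^ P) := by ring
    _ ≤ max A 1 * (|t| ^ (max B 0 * (1 - σ) ^ (3 / 2 : ℝ)) * Real.log |t| ^ P) := by
        rcases le_or_gt 0 A with hA | hA
        · exact mul_le_mul (le_max_left _ _) hfac hb0 (le_trans hA (le_max_left _ _))
        · have h0 : A * (|t| ^ (B * (1 - σ) ^ (3 / 2 : ℝ)) * Real.log |t| ^ P) ≤ 0 :=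
            mul_nonpos_of_nonpos_of_nonneg hA.le hb0
          exact h0.trans (mul_nonneg (le_trans zero_le_one (le_max_right _ _)) hpos)
    _ = _ := by ring

/-- `RichertTypeBoundL A B P → RichertTypeBoundL (max A 1) (max B 0) P`. [folklore] -/
theorem richertTypeL_max {A B P : ℝ} (h : RichertTypeBoundL A B P) :
    RichertTypeBoundL (max A 1) (max B 0) P := by
  intro q _ χ hχ σ t ht h1 h2
  refine (h q χ hχ σ t ht h1 h2).trans ?_
  have hx : 0 ≤ (1 - σ) ^ (3 / 2 : ℝ) := Real.rpow_nonneg (by linarith) _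
  have hfac := rpow_factor_mono (B := B) (B' := max B 0) (P := P) ht hx (le_max_left _ _)
  have hlog : 0 ≤ Real.log |t| := Real.log_nonneg (by linarith)
  have hq1 : (1 : ℝ) ≤ q := by exact_mod_cast NeZero.one_le
  have hlogq : 0 ≤ Real.log q := Real.log_nonneg hq1
  have hQ : 0 ≤ (q : ℝ) ^ (1 - σ) * (1 + Real.log q) := by positivity
  have hb0 : 0 ≤ |t| ^ (B * (1 - σ) ^ (3 / 2 : ℝ)) * Real.log |t| ^ P :=
    mul_nonneg (Real.rpow_nonneg (abs_nonneg t) _) (Real.rpow_nonneg hlog _)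
  have hpos : 0 ≤ |t| ^ (max B 0 * (1 - σ) ^ (3 / 2 : ℝ)) * Real.log |t| ^ P :=
    mul_nonneg (Real.rpow_nonneg (abs_nonneg t) _) (Real.rpow_nonneg hlog _)
  have hA1 : 0 ≤ max A 1 := le_trans zero_le_one (le_max_right _ _)
  calc A * (q : ℝ) ^ (1 - σ) * (1 + Real.log q) * |t| ^ (B * (1 - σ) ^ (3 / 2 : ℝ)) *
        Real.log |t| ^ P
      = A * ((q : ℝ) ^ (1 - σ) * (1 + Real.log q)) *
          (|t| ^ (B * (1 - σ) ^ (3 / 2 : ℝ)) * Real.log |t| ^ P) := by ring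
    _ ≤ max A 1 * ((q : ℝ) ^ (1 - σ) * (1 + Real.log q)) *
          (|t| ^ (max B 0 * (1 - σ) ^ (3 / 2 : ℝ)) * Real.log |t| ^ P) := by
        rcases le_or_gt 0 A with hA | hA
        · exact mul_le_mul (mul_le_mul_of_nonneg_right (le_max_left _ _) hQ) hfac
            hb0 (mul_nonneg hA1 hQ)
        · have h0 : A * ((q : ℝ) ^ (1 - σ) * (1 + Real.log q)) *
              (|t| ^ (B * (1 - σ) ^ (3 / 2 : ℝ)) * Real.log |t| ^ P) ≤ 0 := by
            have : A * ((q : ℝ) ^ (1 - σ) * (1 + Real.log q)) ≤ 0 :=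
              mul_nonpos_of_nonpos_of_nonneg hA.le hQ
            exact mul_nonpos_of_nonpos_of_nonneg this hb0
          exact h0.trans (mul_nonneg (mul_nonneg hA1 hQ) hpos)
    _ = _ := by ring

/-! ### The numerical core of the de la Vallée-Poussin argument -/

/-- If `4/(d + η) ≤ 3/d + E` with `0 < η < d/8`, then `5/(9d) < E`. (With `η < d/8`,
`4/(d + η) > 32/(9d) = 3/d + 5/(9d)`.)  (`δ` is taken by the `LSeries.notation` scope, so the
distance `σ₀ − 1` is called `d` throughout.) [folklore] -/
theorem core_ineq {d η E : ℝ} (hd : 0 < d) (hη : 0 < η) (h : 4 / (d + η) ≤ 3 / d + E)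
    (hηd : η < d / 8) : 5 / (9 * d) < E := by
  have h1 : 32 / (9 * d) < 4 / (d + η) := by
    rw [div_lt_div_iff₀ (by positivity) (by positivity)]
    nlinarith
  have h2 : 32 / (9 * d) = 3 / d + 5 / (9 * d) := by
    field_simp; ring
  linarith

/-- The algebra of the `3-4-1` step: from `0 ≤ 3X₀ + 4X₁ + X₂`, `X₀ ≤ 1/d + K₀`,
`X₁ ≤ E₁ − 1/(d + η)`, `X₂ ≤ E₁` we get `4/(d + η) ≤ 3/d + (3K₀ + 5E₁)`. [folklore] -/
theorem three_four_one_algebra {X₀ X₁ X₂ d η K₀ E₁ : ℝ} (h : 0 ≤ 3 * X₀ + 4 * X₁ + X₂)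
    (h₀ : X₀ ≤ 1 / d + K₀) (h₁ : X₁ ≤ E₁ - 1 / (d + η)) (h₂ : X₂ ≤ E₁) :
    4 / (d + η) ≤ 3 / d + (3 * K₀ + 5 * E₁) := by
  have e₀ : 3 * X₀ ≤ 3 / d + 3 * K₀ := by
    have := mul_le_mul_of_nonneg_left h₀ (by norm_num : (0 : ℝ) ≤ 3)
    have e : (3 : ℝ) * (1 / d + K₀) = 3 / d + 3 * K₀ := by ring
    linarith
  have e₁ : 4 * X₁ ≤ 4 * E₁ - 4 / (d + η) := by
    have := mul_le_mul_of_nonneg_left h₁ (by norm_num : (0 : ℝ) ≤ 4)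
    have e : (4 : ℝ) * (E₁ - 1 / (d + η)) = 4 * E₁ - 4 / (d + η) := by ring
    linarith
  linarith

/-! ### `L(s, χ) ≪ log q + log|t|` for `σ ≥ 1` (partial summation) -/

/-- The tail `∑_{n > M} 1/n² ≤ 1/M` (`M ≥ 1`), from Mathlib's `sum_Ioc_inv_sq_le_sub`. [folklore] -/
theorem tsum_inv_sq_tail_le {M : ℕ} (hM : 1 ≤ M) :
    ∑' n, 1 / ((n + M + 1 : ℕ) : ℝ) ^ 2 ≤ 1 / (M : ℝ) := by
  refine Real.tsum_le_of_sum_range_le (fun n => by positivity) fun N => ?_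
  have hshift : ∑ i ∈ range N, 1 / (((i + M + 1 : ℕ) : ℝ)) ^ 2 =
      ∑ j ∈ Ioc M (M + N), ((j : ℝ) ^ 2)⁻¹ := by
    rw [← Finset.Ico_add_one_add_one_eq_Ioc, Finset.sum_Ico_eq_sum_range]
    simp only [show M + N + 1 - (M + 1) = N by omega, one_div]
    refine sum_congr rfl fun i _ => ?_
    congr 2
    push_cast
    ring
  rw [hshift]
  rcases Nat.eq_zero_or_pos N with rfl | hN
  · simp
  calc ∑ j ∈ Ioc M (M + N), ((j : ℝ) ^ 2)⁻¹ ≤ (M : ℝ)⁻¹ - ((M + N : ℕ) : ℝ)⁻¹ :=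
        sum_Ioc_inv_sq_le_sub (by omega) (Nat.le_add_right M N)
    _ ≤ 1 / (M : ℝ) := by
        rw [one_div]
        have : (0 : ℝ) ≤ ((M + N : ℕ) : ℝ)⁻¹ := by positivity
        linarith

/-- `∑_{n < N} 1/(n+1) ≤ 1 + log N` (Mathlib's `harmonic_le_one_add_log`, cast to `ℝ`). [folklore] -/
theorem sum_range_one_div_succ_le (N : ℕ) :
    ∑ n ∈ range N, 1 / ((n + 1 : ℕ) : ℝ) ≤ 1 + Real.log N := by
  have h := harmonic_le_one_add_log N
  have hcast : ((harmonic N : ℚ) : ℝ) = ∑ n ∈ range N, 1 / ((n + 1 : ℕ) : ℝ) := by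
    simp only [harmonic, Rat.cast_sum, Rat.cast_inv, Rat.cast_natCast, one_div]
  linarith [hcast]

open DirichletAbel in
/-- **`|L(s, χ)| ≤ log q + log|t| + 5`** for `χ ≠ χ₀` mod `q`, `1 ≤ σ ≤ 2`, `|t| ≥ 3`: partial
summation `L(s, χ) = ∑_{n ≤ N} χ(n)n^{-s} − S(N)(N+1)^{-s} + ∑_{n > N} S(n)(n^{-s} − (n+1)^{-s})`
(`S(n) = ∑_{m ≤ n} χ(m)`, `|S(n)| ≤ q`, MV (4.23)) with `N + 1 = q(⌊|s|⌋ + 1)`: the three pieces are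
at most `1 + log N`, `1` and `q|s| ∑_{n > N} n^{-2} ≤ 2`. [cite: MontgomeryVaughan2007, §4.3 eq. (4.23) and Thm. 4.8] -/
theorem norm_LFunction_le_log {q : ℕ} [NeZero q] (χ : DirichletCharacter ℂ q) (hχ : χ ≠ 1)
    {s : ℂ} (h1 : 1 ≤ s.re) (h2 : s.re ≤ 2) (ht : 3 ≤ |s.im|) :
    ‖χ.LFunction s‖ ≤ Real.log q + Real.log |s.im| + 5 := by
  have hs0 : 0 < s.re := by linarith
  have hq1 : 1 ≤ q := NeZero.one_le
  have hq0 : (0 : ℝ) < q := by exact_mod_cast NeZero.pos q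
  -- the size of `s`
  have hsn : ‖s‖ ≤ |s.im| + 2 := by
    have h := Complex.norm_le_abs_re_add_abs_im s
    have : |s.re| ≤ 2 := by rw [abs_le]; constructor <;> linarith
    linarith
  have hsn3 : 3 ≤ ‖s‖ := ht.trans (Complex.abs_im_le_norm s)
  -- `N + 1 = q (⌊‖s‖⌋₊ + 1)`
  set M : ℕ := ⌊‖s‖⌋₊ + 1 with hMdef
  have hM4 : 4 ≤ M := by
    have : 3 ≤ ⌊‖s‖⌋₊ := Nat.le_floor (by exact_mod_cast hsn3)
    omega
  have hMs : ‖s‖ ≤ M := by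
    rw [hMdef]; push_cast; exact (Nat.lt_floor_add_one ‖s‖).le
  have hMle : (M : ℝ) ≤ 2 * |s.im| := by
    rw [hMdef]; push_cast
    have := Nat.floor_le (norm_nonneg s)
    linarith
  set N : ℕ := q * M - 1 with hNdef
  have hqM : 4 ≤ q * M := le_trans hM4 (Nat.le_mul_of_pos_left M (NeZero.pos q))
  have hN1 : N + 1 = q * M := by omega
  have hN3 : 3 ≤ N := by omega
  have hN0 : (0 : ℝ) < N := by exact_mod_cast (show 0 < N by omega)
  have hN1r : ((N + 1 : ℕ) : ℝ) = q * M := by rw [hN1]; push_cast; ring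
  -- split the Abel transform
  rw [LFunction_eq_abelSum χ hχ hs0, abelSum]
  have hsum := summable_term χ hχ hs0
  rw [← hsum.sum_add_tsum_nat_add N]
  have hhead : ∑ i ∈ range N, term χ i s =
      ∑ n ∈ range N, χ ((n + 1 : ℕ) : ZMod q) * ((n + 1 : ℕ) : ℂ) ^ (-s) -
        partialSum χ N * ((N + 1 : ℕ) : ℂ) ^ (-s) := by
    rw [sum_apply_mul_cpow_eq]; ring
  -- (i) the Dirichlet polynomial
  have hA : ‖∑ n ∈ range N, χ ((n + 1 : ℕ) : ZMod q) * ((n + 1 : ℕ) : ℂ) ^ (-s)‖ ≤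
      1 + Real.log N := by
    refine (norm_sum_le _ _).trans (le_trans (Finset.sum_le_sum fun n _ => ?_)
      (sum_range_one_div_succ_le N))
    rw [norm_mul, Complex.norm_natCast_cpow_of_pos (Nat.succ_pos n), Complex.neg_re]
    have hx : (1 : ℝ) ≤ ((n + 1 : ℕ) : ℝ) := by exact_mod_cast Nat.le_add_left 1 n
    have h3 : ((n + 1 : ℕ) : ℝ) ^ (-s.re) ≤ ((n + 1 : ℕ) : ℝ) ^ (-1 : ℝ) :=
      Real.rpow_le_rpow_of_exponent_le hx (by linarith)
    rw [Real.rpow_neg_one, ← one_div] at h3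
    calc ‖χ ((n + 1 : ℕ) : ZMod q)‖ * ((n + 1 : ℕ) : ℝ) ^ (-s.re)
        ≤ 1 * ((n + 1 : ℕ) : ℝ) ^ (-s.re) :=
          mul_le_mul_of_nonneg_right (χ.norm_le_one _) (Real.rpow_nonneg (by positivity) _)
      _ ≤ 1 / ((n + 1 : ℕ) : ℝ) := by rw [one_mul]; exact h3
  -- (ii) the boundary term
  have hB : ‖partialSum χ N * ((N + 1 : ℕ) : ℂ) ^ (-s)‖ ≤ 1 := by
    rw [norm_mul, Complex.norm_natCast_cpow_of_pos (Nat.succ_pos N), Complex.neg_re]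
    have hx : (1 : ℝ) ≤ ((N + 1 : ℕ) : ℝ) := by exact_mod_cast Nat.le_add_left 1 N
    have h3 : ((N + 1 : ℕ) : ℝ) ^ (-s.re) ≤ ((N + 1 : ℕ) : ℝ) ^ (-1 : ℝ) :=
      Real.rpow_le_rpow_of_exponent_le hx (by linarith)
    have h3' : ((N + 1 : ℕ) : ℝ) ^ (-s.re) ≤ ((q : ℝ) * M)⁻¹ := by
      rw [← hN1r, ← Real.rpow_neg_one]; exact h3
    have hM0 : (0 : ℝ) < M := by positivity
    calc ‖partialSum χ N‖ * ((N + 1 : ℕ) : ℝ) ^ (-s.re) ≤ q * ((q : ℝ) * M)⁻¹ :=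
          mul_le_mul (norm_partialSum_le χ hχ N) h3' (Real.rpow_nonneg (by positivity) _) hq0.le
      _ = 1 / M := by field_simp
      _ ≤ 1 := by
          rw [div_le_one hM0]; exact_mod_cast (show 1 ≤ M by omega)
  -- (iii) the tail
  have hC : ‖∑' i, term χ (i + N) s‖ ≤ 2 := by
    have hsumm : Summable (fun i : ℕ => 1 / ((i + N + 1 : ℕ) : ℝ) ^ 2) := by
      have h := (summable_nat_add_iff (N + 1)).2 (Real.summable_one_div_nat_pow.2 one_lt_two)
      refine h.congr fun i => ?_
      simp only [Nat.add_assoc]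
    have hg : ∀ i, ‖term χ (i + N) s‖ ≤ q * ‖s‖ * (1 / ((i + N + 1 : ℕ) : ℝ) ^ 2) := by
      intro i
      refine (norm_term_le χ hχ (i + N) hs0).trans ?_
      have hx : (1 : ℝ) ≤ ((i + N + 1 : ℕ) : ℝ) := by exact_mod_cast Nat.le_add_left 1 _
      have h3 : ((i + N + 1 : ℕ) : ℝ) ^ (-s.re - 1) ≤ ((i + N + 1 : ℕ) : ℝ) ^ (-2 : ℝ) :=
        Real.rpow_le_rpow_of_exponent_le hx (by linarith)
      have e : ((i + N + 1 : ℕ) : ℝ) ^ (-2 : ℝ) = 1 / ((i + N + 1 : ℕ) : ℝ) ^ 2 := by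
        rw [Real.rpow_neg (by positivity), one_div]
        norm_num
      rw [e] at h3
      exact mul_le_mul_of_nonneg_left h3 (by positivity)
    have hT := tsum_inv_sq_tail_le (M := N) (by omega)
    refine (tsum_of_norm_bounded (hsumm.hasSum.mul_left (q * ‖s‖)) hg).trans ?_
    have hqs : (q : ℝ) * ‖s‖ ≤ N + 1 := by
      have : (q : ℝ) * ‖s‖ ≤ q * M := mul_le_mul_of_nonneg_left hMs hq0.le
      rw [← hN1r] at this; push_cast at this; exact this
    have hN1' : (N : ℝ) + 1 ≤ 2 * N := by
      have : (3 : ℝ) ≤ N := by exact_mod_cast hN3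
      linarith
    calc (q : ℝ) * ‖s‖ * ∑' i, 1 / ((i + N + 1 : ℕ) : ℝ) ^ 2 ≤ (2 * N) * (1 / N) :=
          mul_le_mul (hqs.trans hN1') hT (tsum_nonneg fun i => by positivity) (by positivity)
      _ = 2 := by field_simp
  -- assemble
  have hlogN : Real.log N ≤ Real.log q + Real.log |s.im| + 1 := by
    have hM0 : (0 : ℝ) < M := by positivity
    have ht0 : (0 : ℝ) < |s.im| := by linarith
    have h2' : Real.log 2 ≤ 1 := by have := Real.log_two_lt_d9; linarith
    calc Real.log N ≤ Real.log ((N + 1 : ℕ) : ℝ) :=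
          Real.log_le_log hN0 (by push_cast; linarith)
      _ = Real.log q + Real.log M := by
          rw [hN1r, Real.log_mul hq0.ne' hM0.ne']
      _ ≤ Real.log q + Real.log (2 * |s.im|) := by
          gcongr
      _ = Real.log q + (Real.log 2 + Real.log |s.im|) := by
          rw [Real.log_mul (by norm_num) ht0.ne']
      _ ≤ _ := by linarith
  rw [hhead]
  calc ‖∑ n ∈ range N, χ ((n + 1 : ℕ) : ZMod q) * ((n + 1 : ℕ) : ℂ) ^ (-s) -
          partialSum χ N * ((N + 1 : ℕ) : ℂ) ^ (-s) + ∑' i, term χ (i + N) s‖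
      ≤ ‖∑ n ∈ range N, χ ((n + 1 : ℕ) : ZMod q) * ((n + 1 : ℕ) : ℂ) ^ (-s)‖ +
          ‖partialSum χ N * ((N + 1 : ℕ) : ℂ) ^ (-s)‖ + ‖∑' i, term χ (i + N) s‖ :=
        (norm_add_le _ _).trans (add_le_add (norm_sub_le _ _) le_rfl)
    _ ≤ (1 + Real.log N) + 1 + 2 := by gcongr
    _ ≤ Real.log q + Real.log |s.im| + 5 := by linarith

/-! ### Titchmarsh's Lemma α at a point to the right of the zeros -/

/-- **Lemma α, in the form used here.**  Let `f` be holomorphic on `|z − c| < 1/4`, `0 < R ≤ 1/16`,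
`|f| ≤ M` on `|z − c| ≤ 2R`, `‖f(c)‖ ≥ d/2 > 0`, and suppose every zero `a` of `f` with `|a − c| ≤ R`
has `Re a < Re c`.  Then `−Re f'/f(c) ≤ 8(log(2M/d) + 1)/R`, and if `ρ` is a zero of `f` with
`|ρ − c| ≤ R` on the horizontal line through `c`, then
`−Re f'/f(c) ≤ 8(log(2M/d) + 1)/R − 1/(Re c − Re ρ)` (Titchmarsh §3.9 Lemma α:
`f'/f(c) = ∑_a m(a)/(c − a) + ψ(c)`, `|ψ(c)| ≤ 8(log(M/|f(c)|) + 1)/R`, every `Re m(a)/(c − a) ≥ 0`).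
[cite: Titchmarsh1986, §3.9 Lemma α] -/
theorem neg_re_logDeriv_le {f : ℂ → ℂ} {c : ℂ} {R M d : ℝ}
    (hf : DifferentiableOn ℂ f (ball c (1 / 4))) (hR : 0 < R) (hR16 : R ≤ 1 / 16)
    (hM : ∀ z ∈ closedBall c (2 * R), ‖f z‖ ≤ M) (hd : 0 < d) (hfc : d / 2 ≤ ‖f c‖)
    (hzeros : ∀ a, f a = 0 → ‖a - c‖ ≤ R → a.re < c.re) :
    (-(deriv f c / f c)).re ≤ 8 * (Real.log (2 * M / d) + 1) / R ∧
    ∀ ρ : ℂ, f ρ = 0 → ‖ρ - c‖ ≤ R → ρ.im = c.im →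
      (-(deriv f c / f c)).re ≤ 8 * (Real.log (2 * M / d) + 1) / R - 1 / (c.re - ρ.re) := by
  have hfcpos : 0 < ‖f c‖ := lt_of_lt_of_le (by positivity) hfc
  have hfc0 : f c ≠ 0 := norm_pos_iff.1 hfcpos
  have h3R : 3 * R < 1 / 4 := by linarith
  obtain ⟨S, m, ψ, hS, hS', -, hψ, hψb, -⟩ :=
    Literature.Analysis.Complex.titchmarsh_logDeriv_sub_sum_of_differentiableOn hf h3R hfc0 hR hM
  have hMc : ‖f c‖ ≤ M := hM c (mem_closedBall_self (by positivity))
  have hMpos : 0 < M := hfcpos.trans_le hMc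
  have hψc := hψ c (mem_ball_self hR) hfc0
  have hψcb := hψb c (mem_closedBall_self (by positivity))
  have hlog : Real.log (M / ‖f c‖) ≤ Real.log (2 * M / d) := by
    refine Real.log_le_log (div_pos hMpos hfcpos) ?_
    rw [div_le_div_iff₀ hfcpos hd]
    nlinarith
  have hE : ‖ψ c‖ ≤ 8 * (Real.log (2 * M / d) + 1) / R := by
    refine hψcb.trans ?_
    rw [div_le_div_iff_of_pos_right hR]
    nlinarith
  have hSre : ∀ a ∈ S, a.re < c.re := fun a ha ↦ hzeros a (hS a ha).1 (hS a ha).2.2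
  obtain ⟨hnonneg, hge⟩ := ClassicalZFRData.re_sum_div_ge (m := m) hSre
  have hre : (-(deriv f c / f c)).re = -(ψ c).re - (∑ a ∈ S, (m a : ℂ) / (c - a)).re := by
    have : deriv f c / f c = ψ c + ∑ a ∈ S, (m a : ℂ) / (c - a) := by rw [hψc]; ring
    rw [this, Complex.neg_re, Complex.add_re]; ring
  have hψre : -(ψ c).re ≤ 8 * (Real.log (2 * M / d) + 1) / R :=
    le_trans (by linarith [neg_abs_le (ψ c).re, Complex.abs_re_le_norm (ψ c)]) hE
  refine ⟨by rw [hre]; linarith, fun ρ hρ0 hρR hρim ↦ ?_⟩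
  have hρS : ρ ∈ S := hS' ρ hρ0 hρR
  have h1 := hge ρ hρS (hS ρ hρS).2.1
  have hinv : ((c - ρ)⁻¹).re = 1 / (c.re - ρ.re) := by
    have : c - ρ = ((c.re - ρ.re : ℝ) : ℂ) := Complex.ext (by simp) (by simp [hρim])
    rw [this, ← Complex.ofReal_inv, Complex.ofReal_re, one_div]
  rw [hinv] at h1
  rw [hre]
  linarith

/-! ### The parameters of the argument at level `ℓ = log|γ|` -/

/-- `Y(ℓ) = ℓ^{2/3} (log ℓ)^{1/3}`: for `ℓ = log|t|` this is the Vinogradov–Korobov denominator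
`(log|t|)^{2/3}(log log|t|)^{1/3}`. [folklore] -/
def Yv (ℓ : ℝ) : ℝ := ℓ ^ (2 / 3 : ℝ) * Real.log ℓ ^ (1 / 3 : ℝ)

/-- `ℒ = L_q + Y(ℓ)`, the full denominator (`L_q = log q`, or `0` for `ζ`). [folklore] -/
def calL (ℓ Lq : ℝ) : ℝ := Lq + Yv ℓ

/-- The radius `R = log ℓ/(16 ℒ)` of the Lemma-α discs. [folklore] -/
def Rr (ℓ Lq : ℝ) : ℝ := Real.log ℓ / (16 * calL ℓ Lq)

/-- `log 3 > 1`, hence `log ℓ ≥ 1` for `ℓ ≥ 3`. [folklore] -/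
theorem one_le_log {ℓ : ℝ} (hℓ : 3 ≤ ℓ) : 1 ≤ Real.log ℓ := by
  have h : Real.exp 1 ≤ 3 := by have := Real.exp_one_lt_d9; linarith
  calc (1 : ℝ) = Real.log (Real.exp 1) := (Real.log_exp 1).symm
    _ ≤ Real.log ℓ := Real.log_le_log (Real.exp_pos 1) (h.trans hℓ)

/-- `log ℓ ≤ ℓ`. [folklore] -/
theorem log_le_self' {ℓ : ℝ} (hℓ : 0 < ℓ) : Real.log ℓ ≤ ℓ := by
  have := Real.log_le_sub_one_of_pos hℓ; linarith

/-- Basic facts on `Y(ℓ)` for `ℓ ≥ 3`: `0 < Y`, `log ℓ ≤ Y ≤ ℓ` and `Y³ = ℓ² log ℓ`. [folklore] -/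
theorem Yv_facts {ℓ : ℝ} (hℓ : 3 ≤ ℓ) :
    0 < Yv ℓ ∧ Real.log ℓ ≤ Yv ℓ ∧ Yv ℓ ≤ ℓ ∧ Yv ℓ ^ 3 = ℓ ^ 2 * Real.log ℓ := by
  have hℓ0 : 0 < ℓ := by linarith
  have hlam1 := one_le_log hℓ
  have hlam0 : 0 < Real.log ℓ := by linarith
  have hlamℓ := log_le_self' hℓ0
  unfold Yv
  refine ⟨by positivity, ?_, ?_, ?_⟩
  · calc Real.log ℓ = Real.log ℓ ^ (2 / 3 : ℝ) * Real.log ℓ ^ (1 / 3 : ℝ) := by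
          rw [← Real.rpow_add hlam0]; norm_num
      _ ≤ ℓ ^ (2 / 3 : ℝ) * Real.log ℓ ^ (1 / 3 : ℝ) := by
          gcongr
  · calc ℓ ^ (2 / 3 : ℝ) * Real.log ℓ ^ (1 / 3 : ℝ) ≤ ℓ ^ (2 / 3 : ℝ) * ℓ ^ (1 / 3 : ℝ) := by
          gcongr
      _ = ℓ := by rw [← Real.rpow_add hℓ0]; norm_num
  · rw [mul_pow, ← Real.rpow_natCast (ℓ ^ (2 / 3 : ℝ)) 3, ← Real.rpow_mul hℓ0.le,
      ← Real.rpow_natCast (Real.log ℓ ^ (1 / 3 : ℝ)) 3, ← Real.rpow_mul hlam0.le]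
    norm_num

/-- The denominator `ℒ = L_q + Y`, `0 ≤ L_q ≤ ℓ`, `ℓ ≥ 3`: `1 ≤ ℒ`, `log ℓ ≤ ℒ ≤ 2ℓ`,
`log ℒ ≤ log ℓ + 1`. [folklore] -/
theorem calL_facts {ℓ Lq : ℝ} (hℓ : 3 ≤ ℓ) (hLq0 : 0 ≤ Lq) (hLq : Lq ≤ ℓ) :
    1 ≤ calL ℓ Lq ∧ Real.log ℓ ≤ calL ℓ Lq ∧ calL ℓ Lq ≤ 2 * ℓ ∧
      Real.log (calL ℓ Lq) ≤ Real.log ℓ + 1 := by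
  obtain ⟨hY0, hlamY, hYℓ, -⟩ := Yv_facts hℓ
  have hlam1 := one_le_log hℓ
  have hℓ0 : 0 < ℓ := by linarith
  unfold calL
  refine ⟨by linarith, by linarith, by linarith, ?_⟩
  have h2 : Real.log 2 ≤ 1 := by have := Real.log_two_lt_d9; linarith
  calc Real.log (Lq + Yv ℓ) ≤ Real.log (2 * ℓ) := Real.log_le_log (by linarith) (by linarith)
    _ = Real.log 2 + Real.log ℓ := Real.log_mul (by norm_num) hℓ0.ne'
    _ ≤ Real.log ℓ + 1 := by linarith

/-- The radius `R = log ℓ/(16ℒ)`: `0 < R ≤ 1/16`, `R L_q ≤ (log ℓ)/16`, and the key size relation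
`3200 R³ ℓ² ≤ (log ℓ)²` (from `R ≤ log ℓ/(16 Y)` and `Y³ = ℓ² log ℓ`), whence
`(2R)^{3/2} · 2ℓ ≤ (log ℓ)/10`. [folklore] -/
theorem Rr_facts {ℓ Lq : ℝ} (hℓ : 3 ≤ ℓ) (hLq0 : 0 ≤ Lq) (hLq : Lq ≤ ℓ) :
    0 < Rr ℓ Lq ∧ Rr ℓ Lq ≤ 1 / 16 ∧ Rr ℓ Lq * Lq ≤ Real.log ℓ / 16 ∧
      (2 * Rr ℓ Lq) ^ (3 / 2 : ℝ) * (2 * ℓ) ≤ Real.log ℓ / 10 := by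
  obtain ⟨hY0, hlamY, hYℓ, hY3⟩ := Yv_facts hℓ
  obtain ⟨hL1, hlamL, hL2, -⟩ := calL_facts hℓ hLq0 hLq
  have hlam1 := one_le_log hℓ
  have hlam0 : 0 < Real.log ℓ := by linarith
  have hℓ0 : 0 < ℓ := by linarith
  have hL0 : 0 < calL ℓ Lq := by linarith
  have hR0 : 0 < Rr ℓ Lq := by unfold Rr; positivity
  have hRdef : Rr ℓ Lq * (16 * calL ℓ Lq) = Real.log ℓ := by
    unfold Rr; field_simp
  refine ⟨hR0, ?_, ?_, ?_⟩
  · -- `R ≤ 1/16` as `log ℓ ≤ ℒ`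
    rw [Rr, div_le_div_iff₀ (by positivity) (by norm_num)]
    nlinarith
  · -- `R Lq ≤ (log ℓ)/16` as `Lq ≤ ℒ`
    have hLqL : Lq ≤ calL ℓ Lq := by unfold calL; linarith
    rw [Rr, div_mul_eq_mul_div, div_le_div_iff₀ (by positivity) (by norm_num)]
    nlinarith
  · -- `R ≤ log ℓ /(16 Y)`, so `4096 R³ Y³ ≤ (log ℓ)³`, i.e. `4096 R³ ℓ² ≤ (log ℓ)²`
    have hRY : Rr ℓ Lq * (16 * Yv ℓ) ≤ Real.log ℓ := by
      have : Yv ℓ ≤ calL ℓ Lq := by unfold calL; linarith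
      calc Rr ℓ Lq * (16 * Yv ℓ) ≤ Rr ℓ Lq * (16 * calL ℓ Lq) := by gcongr
        _ = Real.log ℓ := hRdef
    have hcube : (Rr ℓ Lq * (16 * Yv ℓ)) ^ 3 ≤ Real.log ℓ ^ 3 :=
      pow_le_pow_left₀ (by positivity) hRY 3
    have hR3 : 4096 * Rr ℓ Lq ^ 3 * ℓ ^ 2 ≤ Real.log ℓ ^ 2 := by
      have e : (Rr ℓ Lq * (16 * Yv ℓ)) ^ 3 = 4096 * Rr ℓ Lq ^ 3 * ℓ ^ 2 * Real.log ℓ := by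
        rw [mul_pow, mul_pow, hY3]; ring
      rw [e] at hcube
      have : Real.log ℓ ^ 3 = Real.log ℓ ^ 2 * Real.log ℓ := by ring
      rw [this] at hcube
      exact le_of_mul_le_mul_right hcube hlam0
    -- compare squares
    have h2R0 : 0 ≤ 2 * Rr ℓ Lq := by positivity
    have hlhs0 : 0 ≤ (2 * Rr ℓ Lq) ^ (3 / 2 : ℝ) * (2 * ℓ) := by positivity
    rw [← pow_le_pow_iff_left₀ hlhs0 (by positivity) two_ne_zero]
    have e1 : ((2 * Rr ℓ Lq) ^ (3 / 2 : ℝ) * (2 * ℓ)) ^ 2 = 32 * Rr ℓ Lq ^ 3 * ℓ ^ 2 := by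
      rw [mul_pow, ← Real.rpow_natCast ((2 * Rr ℓ Lq) ^ (3 / 2 : ℝ)) 2, ← Real.rpow_mul h2R0]
      norm_num
      ring
    rw [e1]
    nlinarith

/-! ### The two discs: upper bounds for `L(z, χ)` and `ζ(z)` on `|z − (1 + d + it)| ≤ 2R` -/

/-- Geometry of the disc `|z − c| ≤ 2R`, `c = (1 + d) + it`, `0 < d ≤ R ≤ 1/16`, `|t| ≥ 4`:
`1 − 2R ≤ Re z ≤ 1 + 3R`, `|Im z| ≥ 3` and `log|Im z| ≤ log|t| + 1`. [folklore] -/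
theorem disc_geom {d R t : ℝ} {z : ℂ} (hd : 0 < d) (hdR : d ≤ R) (hR : R ≤ 1 / 16)
    (ht : 4 ≤ |t|) (hz : z ∈ closedBall (((1 + d : ℝ) : ℂ) + t * I) (2 * R)) :
    1 - 2 * R ≤ z.re ∧ z.re ≤ 1 + 3 * R ∧ 3 ≤ |z.im| ∧ Real.log |z.im| ≤ Real.log |t| + 1 := by
  rw [mem_closedBall, dist_eq_norm] at hz
  have hre := (Complex.abs_re_le_norm (z - (((1 + d : ℝ) : ℂ) + t * I))).trans hz
  have him := (Complex.abs_im_le_norm (z - (((1 + d : ℝ) : ℂ) + t * I))).trans hz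
  have e1 : (z - (((1 + d : ℝ) : ℂ) + t * I)).re = z.re - (1 + d) := by simp
  have e2 : (z - (((1 + d : ℝ) : ℂ) + t * I)).im = z.im - t := by simp
  rw [e1, abs_le] at hre
  rw [e2, abs_le] at him
  have h3 : 3 ≤ |z.im| := by
    have := abs_sub_abs_le_abs_sub t z.im
    have : |t - z.im| ≤ 2 * R := by rw [abs_sub_comm, abs_le]; exact him
    linarith
  have ht0 : 0 < |t| := by linarith
  have h4 : |z.im| ≤ 2 * |t| := by
    have := abs_sub_abs_le_abs_sub z.im t
    have : |z.im - t| ≤ 2 * R := abs_le.2 him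
    linarith
  refine ⟨by linarith, by linarith, h3, ?_⟩
  have h2 : Real.log 2 ≤ 1 := by have := Real.log_two_lt_d9; linarith
  calc Real.log |z.im| ≤ Real.log (2 * |t|) := Real.log_le_log (by linarith) h4
    _ = Real.log 2 + Real.log |t| := Real.log_mul (by norm_num) ht0.ne'
    _ ≤ Real.log |t| + 1 := by linarith

/-- Powers of `ℓ ≥ 1` against `ℓ^{p}`, `p = P + 3 + B/10` (`B, P ≥ 0`):
`ℓ² ℓ^{B/10} ℓ^P ≤ ℓ^p`, `ℓ^{B/10} ℓ^P ≤ ℓ^p`, `ℓ ≤ ℓ^p`, and `(2ℓ)^P = 2^P ℓ^P`. [folklore] -/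
theorem ell_pow_facts {ℓ B P : ℝ} (hℓ : 1 ≤ ℓ) (hB : 0 ≤ B) (hP : 0 ≤ P) :
    ℓ ^ (2 : ℕ) * ℓ ^ (B / 10) * ℓ ^ P ≤ ℓ ^ (P + 3 + B / 10) ∧
      ℓ ^ (B / 10) * ℓ ^ P ≤ ℓ ^ (P + 3 + B / 10) ∧ ℓ ≤ ℓ ^ (P + 3 + B / 10) ∧
        (2 * ℓ) ^ P = 2 ^ P * ℓ ^ P := by
  have hℓ0 : 0 < ℓ := by linarith
  refine ⟨?_, ?_, ?_, Real.mul_rpow (by norm_num) hℓ0.le⟩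
  · rw [← Real.rpow_natCast ℓ 2, ← Real.rpow_add hℓ0, ← Real.rpow_add hℓ0]
    exact Real.rpow_le_rpow_of_exponent_le hℓ (by push_cast; linarith)
  · rw [← Real.rpow_add hℓ0]
    exact Real.rpow_le_rpow_of_exponent_le hℓ (by linarith)
  · calc ℓ = ℓ ^ (1 : ℝ) := (Real.rpow_one ℓ).symm
      _ ≤ ℓ ^ (P + 3 + B / 10) := Real.rpow_le_rpow_of_exponent_le hℓ (by linarith)

/-- The Richert factor on the disc: if `0 ≤ 1 − σ' ≤ 2R`, `3 ≤ |t'|`, `log|t'| ≤ 2ℓ` and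
`(2R)^{3/2} · 2ℓ ≤ (log ℓ)/10`, then `|t'|^{B(1−σ')^{3/2}} ≤ ℓ^{B/10}` and `(log|t'|)^{P} ≤ (2ℓ)^P`
(`B, P ≥ 0`, `ℓ ≥ 3`). [folklore] -/
theorem richert_factors_le {B P R ℓ σ' t' : ℝ} (hB : 0 ≤ B) (hP : 0 ≤ P) (hℓ : 3 ≤ ℓ)
    (h0 : 0 ≤ 1 - σ') (h1 : 1 - σ' ≤ 2 * R) (ht' : 3 ≤ |t'|) (hlog : Real.log |t'| ≤ 2 * ℓ)
    (hRexp : (2 * R) ^ (3 / 2 : ℝ) * (2 * ℓ) ≤ Real.log ℓ / 10) :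
    |t'| ^ (B * (1 - σ') ^ (3 / 2 : ℝ)) ≤ ℓ ^ (B / 10) ∧ Real.log |t'| ^ P ≤ (2 * ℓ) ^ P := by
  have hℓ0 : 0 < ℓ := by linarith
  have ht0 : 0 < |t'| := by linarith
  have hlog0 : 0 ≤ Real.log |t'| := Real.log_nonneg (by linarith)
  constructor
  · rw [Real.rpow_def_of_pos ht0, Real.rpow_def_of_pos hℓ0, Real.exp_le_exp]
    have hx : (1 - σ') ^ (3 / 2 : ℝ) ≤ (2 * R) ^ (3 / 2 : ℝ) := Real.rpow_le_rpow h0 h1 (by norm_num)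
    have hx0 : 0 ≤ (1 - σ') ^ (3 / 2 : ℝ) := Real.rpow_nonneg h0 _
    have hkey : (1 - σ') ^ (3 / 2 : ℝ) * Real.log |t'| ≤ Real.log ℓ / 10 :=
      le_trans (mul_le_mul hx hlog hlog0 (Real.rpow_nonneg (by linarith) _)) hRexp
    calc Real.log |t'| * (B * (1 - σ') ^ (3 / 2 : ℝ))
        = B * ((1 - σ') ^ (3 / 2 : ℝ) * Real.log |t'|) := by ring
      _ ≤ B * (Real.log ℓ / 10) := mul_le_mul_of_nonneg_left hkey hB
      _ = Real.log ℓ * (B / 10) := by ring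
  · exact Real.rpow_le_rpow hlog0 hlog hP

/-- **The disc bound for `L(z, χ)`** (`χ ≠ χ₀`, regime `log q ≤ ℓ`).  Let `ℓ ≥ 3`, `log q ≤ ℓ`,
`R = R(ℓ, log q)`, `0 < d ≤ R`, `|t| ≥ 4` with `log|t| ≤ ℓ + 1`.  Then on `|z − (1 + d + it)| ≤ 2R`:
`|L(z, χ)| ≤ 2^{P+1}A ℓ^{P + 3 + B/10} + 42ℓ` — for `Re z ≤ 1` by the Richert-type bound
(`q^{1−σ'} ≤ e^{2R log q} ≤ ℓ^{1/8}`, `1 + log q ≤ 2ℓ`, `|t'|^{B(1−σ')^{3/2}} ≤ ℓ^{B/10}`,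
`(log|t'|)^{P} ≤ (2ℓ)^P`), for `Re z ≥ 1` by `|L| ≤ log q + log|t'| + 5 ≤ 5ℓ`. [folklore] -/
theorem norm_LFunction_le_on_disc {A B P : ℝ} (hRL : RichertTypeBoundL A B P) (hA : 1 ≤ A)
    (hB : 0 ≤ B) (hP : 0 ≤ P) {q : ℕ} [NeZero q] {χ : DirichletCharacter ℂ q} (hχ : χ ≠ 1) {ℓ : ℝ}
    (hℓ : 3 ≤ ℓ) (hq : Real.log q ≤ ℓ) {t d : ℝ} (ht : 4 ≤ |t|) (htℓ : Real.log |t| ≤ ℓ + 1)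
    (hd : 0 < d) (hdR : d ≤ Rr ℓ (Real.log q)) :
    ∀ z ∈ closedBall (((1 + d : ℝ) : ℂ) + t * I) (2 * Rr ℓ (Real.log q)),
      ‖χ.LFunction z‖ ≤ 2 ^ (P + 1) * A * ℓ ^ (P + 3 + B / 10) + 42 * ℓ := by
  intro z hz
  have hlogq : 0 ≤ Real.log q := Real.log_natCast_nonneg q
  have hq0 : (0 : ℝ) < q := by exact_mod_cast NeZero.pos q
  obtain ⟨hR0, hR16, hRLq, hRexp⟩ := Rr_facts hℓ hlogq hq
  set R := Rr ℓ (Real.log q) with hRdef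
  obtain ⟨hzre1, hzre2, hzim3, hzimlog⟩ := disc_geom hd hdR hR16 ht hz
  have hℓ1 : 1 ≤ ℓ := by linarith
  have hℓ0 : 0 < ℓ := by linarith
  have hlam0 : 0 ≤ Real.log ℓ := Real.log_nonneg hℓ1
  have hlogz : Real.log |z.im| ≤ 2 * ℓ := by linarith
  obtain ⟨hpow2, -, hℓp, h2ℓP⟩ := ell_pow_facts hℓ1 hB hP
  have h2P1 : (2 : ℝ) ^ (P + 1) = 2 ^ P * 2 := by
    rw [Real.rpow_add (by norm_num), Real.rpow_one]
  have h2P0 : 0 < (2 : ℝ) ^ P := Real.rpow_pos_of_pos (by norm_num) _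
  have hℓB : 0 ≤ ℓ ^ (P + 3 + B / 10) := Real.rpow_nonneg hℓ0.le _
  have hbig : 0 ≤ 2 ^ (P + 1) * A * ℓ ^ (P + 3 + B / 10) := by
    rw [h2P1]; have : 0 ≤ A := by linarith
    positivity
  rcases le_or_gt z.re 1 with hzre | hzre
  · have h := hRL q χ hχ z.re z.im hzim3 (by linarith) hzre
    rw [Complex.re_add_im] at h
    obtain ⟨hfac3, hfac4⟩ := richert_factors_le (σ' := z.re) hB hP hℓ (by linarith) (by linarith)
      hzim3 hlogz hRexp
    have hlz0 : 0 ≤ Real.log |z.im| ^ P := Real.rpow_nonneg (Real.log_nonneg (by linarith)) _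
    have hfac1 : (q : ℝ) ^ (1 - z.re) ≤ ℓ := by
      rw [Real.rpow_def_of_pos hq0]
      calc Real.exp (Real.log q * (1 - z.re)) ≤ Real.exp (Real.log q * (2 * R)) := by
            gcongr; linarith
        _ ≤ Real.exp (Real.log ℓ) := by
            rw [Real.exp_le_exp]
            nlinarith
        _ = ℓ := Real.exp_log hℓ0
    have hfac2 : 1 + Real.log q ≤ 2 * ℓ := by linarith
    calc ‖χ.LFunction z‖
        ≤ A * (q : ℝ) ^ (1 - z.re) * (1 + Real.log q) *
            |z.im| ^ (B * (1 - z.re) ^ (3 / 2 : ℝ)) * Real.log |z.im| ^ P := h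
      _ ≤ A * ℓ * (2 * ℓ) * ℓ ^ (B / 10) * (2 * ℓ) ^ P := by gcongr
      _ = 2 ^ P * 2 * A * (ℓ ^ (2 : ℕ) * ℓ ^ (B / 10) * ℓ ^ P) := by rw [h2ℓP]; ring
      _ ≤ 2 ^ P * 2 * A * ℓ ^ (P + 3 + B / 10) := by gcongr
      _ = 2 ^ (P + 1) * A * ℓ ^ (P + 3 + B / 10) := by rw [h2P1]
      _ ≤ 2 ^ (P + 1) * A * ℓ ^ (P + 3 + B / 10) + 42 * ℓ := by linarith
  · have h := norm_LFunction_le_log χ hχ hzre.le (by linarith) hzim3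
    linarith

/-- **The disc bound for `ζ(z)`.**  Let `ℓ ≥ 3`, `0 ≤ L_q ≤ ℓ`, `R = R(ℓ, L_q)`, `0 < d ≤ R`,
`|t| ≥ 4` with `log|t| ≤ ℓ + 1`.  Then on `|z − (1 + d + it)| ≤ 2R`:
`|ζ(z)| ≤ 2^{P+1}A ℓ^{P + 3 + B/10} + 42ℓ` — for `Re z ≤ 1` by the Richert-type bound, for `Re z ≥ 1`
by Titchmarsh's Theorem 3.5 (`|ζ| ≤ 21 log|t'| ≤ 42ℓ`, `ZetaOneLine.norm_riemannZeta_le_log`).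
[folklore] -/
theorem norm_zeta_le_on_disc {A B P : ℝ} (hRζ : RichertTypeBound A B P) (hA : 1 ≤ A) (hB : 0 ≤ B)
    (hP : 0 ≤ P) {ℓ Lq : ℝ} (hℓ : 3 ≤ ℓ) (hLq0 : 0 ≤ Lq) (hLq : Lq ≤ ℓ) {t d : ℝ} (ht : 4 ≤ |t|)
    (htℓ : Real.log |t| ≤ ℓ + 1) (hd : 0 < d) (hdR : d ≤ Rr ℓ Lq) :
    ∀ z ∈ closedBall (((1 + d : ℝ) : ℂ) + t * I) (2 * Rr ℓ Lq),
      ‖riemannZeta z‖ ≤ 2 ^ (P + 1) * A * ℓ ^ (P + 3 + B / 10) + 42 * ℓ := by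
  intro z hz
  obtain ⟨hR0, hR16, -, hRexp⟩ := Rr_facts hℓ hLq0 hLq
  set R := Rr ℓ Lq with hRdef
  obtain ⟨hzre1, hzre2, hzim3, hzimlog⟩ := disc_geom hd hdR hR16 ht hz
  have hℓ1 : 1 ≤ ℓ := by linarith
  have hℓ0 : 0 < ℓ := by linarith
  have hlogz : Real.log |z.im| ≤ 2 * ℓ := by linarith
  obtain ⟨-, hpowBP, hℓp, h2ℓP⟩ := ell_pow_facts hℓ1 hB hP
  have h2P1 : (2 : ℝ) ^ (P + 1) = 2 ^ P * 2 := by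
    rw [Real.rpow_add (by norm_num), Real.rpow_one]
  have h2P0 : 0 < (2 : ℝ) ^ P := Real.rpow_pos_of_pos (by norm_num) _
  have hℓB : 0 ≤ ℓ ^ (P + 3 + B / 10) := Real.rpow_nonneg hℓ0.le _
  have hA0 : 0 ≤ A := by linarith
  have hbig : 0 ≤ 2 ^ (P + 1) * A * ℓ ^ (P + 3 + B / 10) := by rw [h2P1]; positivity
  rcases le_or_gt z.re 1 with hzre | hzre
  · have h := hRζ z.re z.im hzim3 (by linarith) hzre
    rw [Complex.re_add_im] at h
    obtain ⟨hfac3, hfac4⟩ := richert_factors_le (σ' := z.re) hB hP hℓ (by linarith) (by linarith)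
      hzim3 hlogz hRexp
    have hlz0 : 0 ≤ Real.log |z.im| ^ P := Real.rpow_nonneg (Real.log_nonneg (by linarith)) _
    calc ‖riemannZeta z‖ ≤ A * |z.im| ^ (B * (1 - z.re) ^ (3 / 2 : ℝ)) * Real.log |z.im| ^ P := h
      _ ≤ A * ℓ ^ (B / 10) * (2 * ℓ) ^ P := by gcongr
      _ = 2 ^ P * A * (ℓ ^ (B / 10) * ℓ ^ P) := by rw [h2ℓP]; ring
      _ ≤ 2 ^ P * A * ℓ ^ (P + 3 + B / 10) := by gcongr
      _ ≤ 2 ^ P * 2 * A * ℓ ^ (P + 3 + B / 10) := by nlinarith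
      _ = 2 ^ (P + 1) * A * ℓ ^ (P + 3 + B / 10) := by rw [h2P1]
      _ ≤ 2 ^ (P + 1) * A * ℓ ^ (P + 3 + B / 10) + 42 * ℓ := by nlinarith
  · have hlog3 : 0 < Real.log |z.im| :=
      Real.log_pos (by linarith)
    have hσ : 1 - 1 / (2 * Real.log |z.im|) ≤ z.re := by
      have : 0 < 1 / (2 * Real.log |z.im|) := by positivity
      linarith
    have h := ZetaOneLine.norm_riemannZeta_le_log hzim3 hσ
    nlinarith

/-! ### The constants, and the contradiction for a zero too close to `σ = 1` -/

/-- The master constant `W = 3K₀ + 640(log(2^{P+1}A + 42) + (P + 3 + B/10) + 7)`; the final region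
has `c = 1/(128 W²)` in the `t`-dominant regime. [folklore] -/
def Wc (A B P K₀ : ℝ) : ℝ := 3 * K₀ + 640 * (Real.log (2 ^ (P + 1) * A + 42) + (P + 3 + B / 10) + 7)

/-- The distance `d = σ₀ − 1 = W⁻²/(16ℒ)` of the auxiliary point `σ₀ + iγ` from the line `σ = 1`.
[folklore] -/
def dd (A B P K₀ ℓ Lq : ℝ) : ℝ := (1 / Wc A B P K₀ ^ 2) / (16 * calL ℓ Lq)

/-- The common disc bound `M = 2^{P+1}A ℓ^{P + 3 + B/10} + 42ℓ`. [folklore] -/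
def Mm (A B P ℓ : ℝ) : ℝ := 2 ^ (P + 1) * A * ℓ ^ (P + 3 + B / 10) + 42 * ℓ

/-- The Lemma-α error `E = 8(log(2M/d) + 1)/R`. [folklore] -/
def EE (A B P K₀ ℓ Lq : ℝ) : ℝ := 8 * (Real.log (2 * Mm A B P ℓ / dd A B P K₀ ℓ Lq) + 1) / Rr ℓ Lq

set_option maxHeartbeats 400000 in
/-- Sizes of the constants: `W ≥ 6400`, `0 < d`, `2d ≤ R`, `d ≤ 1`, `0 < M`, and the decisive estimate
`3K₀ + 5E ≤ W² ℒ < 5/(9d) = (80/9) W² ℒ`. [folklore] -/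
theorem const_facts {A B P K₀ ℓ Lq : ℝ} (hA : 1 ≤ A) (hB : 0 ≤ B) (hP : 0 ≤ P) (hK₀ : 0 ≤ K₀)
    (hℓ : 3 ≤ ℓ) (hLq0 : 0 ≤ Lq) (hLq : Lq ≤ ℓ) :
    6400 ≤ Wc A B P K₀ ∧ 0 < dd A B P K₀ ℓ Lq ∧ 2 * dd A B P K₀ ℓ Lq ≤ Rr ℓ Lq ∧
      dd A B P K₀ ℓ Lq ≤ 1 ∧ 0 < Mm A B P ℓ ∧
        3 * K₀ + 5 * EE A B P K₀ ℓ Lq < 5 / (9 * dd A B P K₀ ℓ Lq) := by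
  obtain ⟨hY0, hlamY, hYℓ, -⟩ := Yv_facts hℓ
  obtain ⟨hL1, hlamL, hL2, hlogL⟩ := calL_facts hℓ hLq0 hLq
  obtain ⟨hR0, hR16, -, -⟩ := Rr_facts hℓ hLq0 hLq
  have hlam1 := one_le_log hℓ
  have hℓ0 : 0 < ℓ := by linarith
  have hℓ1 : 1 ≤ ℓ := by linarith
  have hL0 : 0 < calL ℓ Lq := by linarith
  have hlam0 : 0 < Real.log ℓ := by linarith
  set W := Wc A B P K₀ with hWdef
  set p : ℝ := P + 3 + B / 10 with hpdef
  have hp0 : 3 ≤ p := by rw [hpdef]; linarith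
  have h2P1 : (2 : ℝ) ^ (P + 1) = 2 ^ P * 2 := by
    rw [Real.rpow_add (by norm_num), Real.rpow_one]
  have h2P0 : 0 < (2 : ℝ) ^ P := Real.rpow_pos_of_pos (by norm_num) _
  have hA2 : 2 ≤ (2 : ℝ) ^ (P + 1) * A := by
    rw [h2P1]
    have : (1 : ℝ) ≤ 2 ^ P := Real.one_le_rpow (by norm_num) hP
    nlinarith
  have hlogA : 0 ≤ Real.log (2 ^ (P + 1) * A + 42) := Real.log_nonneg (by linarith)
  have hWe : W = 3 * K₀ + 640 * (Real.log (2 ^ (P + 1) * A + 42) + p + 7) := by rw [hWdef, Wc]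
  have hW : 6400 ≤ W := by rw [hWe]; nlinarith
  have hW0 : 0 < W := by linarith
  set d := dd A B P K₀ ℓ Lq with hddef
  have hd_eq : d = 1 / (16 * W ^ 2 * calL ℓ Lq) := by
    rw [hddef, dd, ← hWdef]; field_simp
  have hd0 : 0 < d := by rw [hd_eq]; positivity
  have hdR : 2 * d ≤ Rr ℓ Lq := by
    rw [hd_eq, Rr, mul_one_div, div_le_div_iff₀ (by positivity) (by positivity)]
    have h1 : (2 : ℝ) ≤ Real.log ℓ * W ^ 2 := by nlinarith
    nlinarith [mul_le_mul_of_nonneg_right h1 (by positivity : (0 : ℝ) ≤ 16 * calL ℓ Lq)]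
  have hd1 : d ≤ 1 := by linarith
  set M := Mm A B P ℓ with hMdef
  obtain ⟨-, -, hℓp, -⟩ := ell_pow_facts hℓ1 hB hP
  have hℓp0 : 0 < ℓ ^ p := Real.rpow_pos_of_pos hℓ0 _
  have hM0 : 0 < M := by
    rw [hMdef, Mm]
    have : 0 < (2 : ℝ) ^ (P + 1) * A * ℓ ^ p := by positivity
    positivity
  have hMle : M ≤ (2 ^ (P + 1) * A + 42) * ℓ ^ p := by
    rw [hMdef, Mm]; nlinarith
  refine ⟨hW, hd0, hdR, hd1, hM0, ?_⟩
  -- `log(2M/d) + 1 ≤ Cc λ`, `Cc = log(4A+42) + p + 7 + 2 log W`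
  set Cc : ℝ := Real.log (2 ^ (P + 1) * A + 42) + p + 7 + 2 * Real.log W with hCcdef
  have hlogM : Real.log M ≤ Real.log (2 ^ (P + 1) * A + 42) + p * Real.log ℓ := by
    calc Real.log M ≤ Real.log ((2 ^ (P + 1) * A + 42) * ℓ ^ p) := Real.log_le_log hM0 hMle
      _ = Real.log (2 ^ (P + 1) * A + 42) + p * Real.log ℓ := by
          rw [Real.log_mul (by linarith) hℓp0.ne', Real.log_rpow hℓ0]
  have hlog16 : Real.log 16 ≤ 3 := by
    have h2 := Real.log_two_lt_d9
    have : Real.log 16 = 4 * Real.log 2 := by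
      rw [show (16 : ℝ) = 2 ^ 4 by norm_num, Real.log_pow]; norm_num
    linarith
  have hlog2 : Real.log 2 ≤ 1 := by have := Real.log_two_lt_d9; linarith
  have hlogW : 0 ≤ Real.log W := Real.log_nonneg (by linarith)
  have hlogWle : Real.log W ≤ W := log_le_self' hW0
  have hlogd : Real.log (1 / d) ≤ 4 + Real.log ℓ + 2 * Real.log W := by
    rw [hd_eq, one_div_one_div, Real.log_mul (by positivity) hL0.ne',
      Real.log_mul (by norm_num) (by positivity), Real.log_pow]
    push_cast
    linarith
  have hlog2Md : Real.log (2 * M / d) + 1 ≤ Cc * Real.log ℓ := by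
    have e : Real.log (2 * M / d) = Real.log 2 + Real.log M + Real.log (1 / d) := by
      rw [Real.log_div (by positivity) hd0.ne', Real.log_mul (by norm_num) hM0.ne', one_div,
        Real.log_inv]
      ring
    rw [e]
    have hC0 : 0 ≤ Real.log (2 ^ (P + 1) * A + 42) + 6 + 2 * Real.log W := by positivity
    have h1 : Real.log 2 + Real.log M + Real.log (1 / d) + 1 ≤
        (Real.log (2 ^ (P + 1) * A + 42) + 6 + 2 * Real.log W) + (p + 1) * Real.log ℓ := by
      linarith
    have h2 : (Real.log (2 ^ (P + 1) * A + 42) + 6 + 2 * Real.log W) ≤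
        (Real.log (2 ^ (P + 1) * A + 42) + 6 + 2 * Real.log W) * Real.log ℓ :=
      le_mul_of_one_le_right hC0 hlam1
    have h3 : (Real.log (2 ^ (P + 1) * A + 42) + 6 + 2 * Real.log W) * Real.log ℓ +
        (p + 1) * Real.log ℓ = Cc * Real.log ℓ := by rw [hCcdef]; ring
    linarith
  have hCc0 : 0 ≤ Cc := by rw [hCcdef]; positivity
  -- `E ≤ 128 Cc ℒ`
  have hE : EE A B P K₀ ℓ Lq ≤ 128 * Cc * calL ℓ Lq := by
    have hEdef : EE A B P K₀ ℓ Lq =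
        8 * (Real.log (2 * M / d) + 1) * (16 * calL ℓ Lq) / Real.log ℓ := by
      rw [EE, ← hMdef, ← hddef, Rr, div_div_eq_mul_div]
    rw [hEdef, div_le_iff₀ hlam0]
    have := mul_le_mul_of_nonneg_right hlog2Md (by positivity : (0 : ℝ) ≤ 8 * (16 * calL ℓ Lq))
    have e1 : (Real.log (2 * M / d) + 1) * (8 * (16 * calL ℓ Lq)) =
        8 * (Real.log (2 * M / d) + 1) * (16 * calL ℓ Lq) := by ring
    have e2 : Cc * Real.log ℓ * (8 * (16 * calL ℓ Lq)) = 128 * Cc * calL ℓ Lq * Real.log ℓ := by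
      ring
    linarith
  -- conclude
  have hfin : 3 * K₀ + 5 * EE A B P K₀ ℓ Lq ≤ W ^ 2 * calL ℓ Lq := by
    have hK₀L : 3 * K₀ ≤ 3 * K₀ * calL ℓ Lq := le_mul_of_one_le_right (by positivity) hL1
    have h1 : 3 * K₀ + 5 * EE A B P K₀ ℓ Lq ≤ (3 * K₀ + 640 * Cc) * calL ℓ Lq := by
      have e : (3 * K₀ + 640 * Cc) * calL ℓ Lq = 3 * K₀ * calL ℓ Lq + 5 * (128 * Cc * calL ℓ Lq) := by
        ring
      linarith
    have h2 : 3 * K₀ + 640 * Cc ≤ W ^ 2 := by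
      have e : 3 * K₀ + 640 * Cc = W + 1280 * Real.log W := by rw [hCcdef, hWe]; ring
      rw [e]
      have h3 : W * 1281 ≤ W * W := mul_le_mul_of_nonneg_left (by linarith) hW0.le
      have h4 : W ^ 2 = W * W := sq W
      linarith
    exact h1.trans (mul_le_mul_of_nonneg_right h2 hL0.le)
  have hlast : W ^ 2 * calL ℓ Lq < 5 / (9 * d) := by
    have e : 5 / (9 * d) = 80 * (W ^ 2 * calL ℓ Lq) / 9 := by
      rw [hd_eq]; field_simp; ring
    rw [e]
    have : 0 < W ^ 2 * calL ℓ Lq := by positivity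
    linarith
  exact hfin.trans_lt hlast

/-! ### A zero of `L(s, χ)` in the `t`-dominant regime (`log q ≤ log|γ|`) -/

/-- `e³ < 21`, so `log x ≥ 3` for `x ≥ 21`. [folklore] -/
theorem three_le_log_of_ge {x : ℝ} (hx : 21 ≤ x) : 3 ≤ Real.log x := by
  have h1 : Real.exp 1 < 2.7182818286 := Real.exp_one_lt_d9
  have h3 : Real.exp 3 ≤ 21 := by
    have e : Real.exp 3 = Real.exp 1 ^ 3 := by rw [← Real.exp_nat_mul]; norm_num
    rw [e]
    have h0 : 0 ≤ Real.exp 1 := (Real.exp_pos 1).le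
    have := pow_le_pow_left₀ h0 h1.le 3
    nlinarith
  calc (3 : ℝ) = Real.log (Real.exp 3) := (Real.log_exp 3).symm
    _ ≤ Real.log x := Real.log_le_log (Real.exp_pos 3) (h3.trans hx)

/-- `ζ` is holomorphic on a disc of radius `1/4` about a point of height `|Im c| ≥ 1`. [folklore] -/
theorem differentiableOn_zeta_ball {c : ℂ} (hc : 1 ≤ |c.im|) :
    DifferentiableOn ℂ riemannZeta (ball c (1 / 4)) := by
  intro z hz
  refine (differentiableAt_riemannZeta ?_).differentiableWithinAt
  intro h1
  rw [mem_ball, dist_eq_norm] at hz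
  have him := (Complex.abs_im_le_norm (z - c)).trans hz.le
  rw [h1] at him
  simp at him
  have : |c.im| ≤ 1 / 4 := by rw [abs_le]; rw [abs_le] at him; constructor <;> linarith
  linarith

/-- **A zero of `L(s, χ)`, `χ ≠ χ₀`, in the regime `log q ≤ ℓ = log|γ|` lies at distance
`≥ d/8 = 1/(128 W² ℒ)` from `σ = 1`** (`|γ| ≥ 21`).  Landau's argument: with `d`, `R`, `M`, `E` as
above, Lemma α gives `−Re L'/L(1 + d + iγ, χ) ≤ E − 1/(1 + d − β)` and
`−Re L'/L(1 + d + 2iγ, χ²) ≤ E` (third function `ζ(1 + d + 2iγ)` if `χ² = χ₀`), while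
`−ζ'/ζ(1 + d) ≤ 1/d + K₀`; the `3-4-1` inequality (MV Lemma 11.2) then forces
`4/(d + η) ≤ 3/d + 3K₀ + 5E`, impossible for `η < d/8` by `const_facts`.
[cite: Titchmarsh1986, Theorem 3.10 (proof)] [cite: MontgomeryVaughan2007, Lemma 11.2] -/
theorem one_sub_re_ge_L {A B P K₀ : ℝ} (hRζ : RichertTypeBound A B P)
    (hRL : RichertTypeBoundL A B P) (hA : 1 ≤ A) (hB : 0 ≤ B) (hP : 0 ≤ P) (hK₀ : 0 ≤ K₀)
    (hK : ∀ σ : ℝ, 1 < σ → σ ≤ 2 → Summable (fun n : ℕ ↦ Λ n / (n : ℝ) ^ σ) ∧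
      ∑' n : ℕ, Λ n / (n : ℝ) ^ σ ≤ 1 / (σ - 1) + K₀)
    {q : ℕ} [NeZero q] {χ : DirichletCharacter ℂ q} (hχ : χ ≠ 1) {ρ : ℂ}
    (hρ : χ.LFunction ρ = 0) (hγ : 21 ≤ |ρ.im|) (hq : Real.log q ≤ Real.log |ρ.im|) :
    dd A B P K₀ (Real.log |ρ.im|) (Real.log q) / 8 ≤ 1 - ρ.re := by
  set γ : ℝ := ρ.im with hγdef
  set ℓ : ℝ := Real.log |γ| with hℓdef
  have hℓ : 3 ≤ ℓ := three_le_log_of_ge hγ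
  have hLq0 : 0 ≤ Real.log (q : ℝ) := Real.log_natCast_nonneg q
  obtain ⟨hW, hd0, h2dR, hd1, hM0, hdec⟩ := const_facts hA hB hP hK₀ hℓ hLq0 hq
  obtain ⟨hR0, hR16, -, -⟩ := Rr_facts hℓ hLq0 hq
  set d := dd A B P K₀ ℓ (Real.log q) with hddef
  set R := Rr ℓ (Real.log q) with hRdef
  set M := Mm A B P ℓ with hMdef
  set E := EE A B P K₀ ℓ (Real.log q) with hEdef
  have hE_eq : E = 8 * (Real.log (2 * M / d) + 1) / R := by rw [hEdef, EE]
  have hdR : d ≤ R := by linarith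
  -- `β < 1`, `η = 1 − β > 0`
  have hβ1 : ρ.re < 1 := by
    by_contra hcon
    exact DirichletCharacter.LFunction_ne_zero_of_one_le_re χ (Or.inl hχ) (not_lt.1 hcon) hρ
  by_contra hlt
  rw [not_le] at hlt
  set η : ℝ := 1 - ρ.re with hηdef
  have hη0 : 0 < η := by rw [hηdef]; linarith
  -- heights
  have hγ0 : 0 < |γ| := by linarith
  have hγ4 : 4 ≤ |γ| := by linarith
  have h2γ4 : 4 ≤ |2 * γ| := by rw [abs_mul, abs_two]; linarith
  have hγℓ : Real.log |γ| ≤ ℓ + 1 := by rw [hℓdef]; linarith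
  have hlog2 : Real.log 2 ≤ 1 := by have := Real.log_two_lt_d9; linarith
  have h2γℓ : Real.log |2 * γ| ≤ ℓ + 1 := by
    rw [abs_mul, abs_two, Real.log_mul (by norm_num) hγ0.ne', hℓdef]; linarith
  -- the points
  have hσ : 1 < 1 + d := by linarith
  set c₁ : ℂ := ((1 + d : ℝ) : ℂ) + (γ : ℂ) * I with hc₁def
  set c₂ : ℂ := ((1 + d : ℝ) : ℂ) + ((2 * γ : ℝ) : ℂ) * I with hc₂def
  have hc₁re : c₁.re = 1 + d := by simp [hc₁def]
  have hc₁im : c₁.im = γ := by simp [hc₁def]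
  have hc₂re : c₂.re = 1 + d := by simp [hc₂def]
  have hc₂im : c₂.im = 2 * γ := by simp [hc₂def]
  have hc₁1 : 1 < c₁.re := by rw [hc₁re]; exact hσ
  have hc₂1 : 1 < c₂.re := by rw [hc₂re]; exact hσ
  have e₂ : ((1 + d : ℝ) : ℂ) + 2 * (γ : ℂ) * I = c₂ := by
    rw [hc₂def]; push_cast; ring
  -- lower bounds at the centres
  have hlow : ∀ {c : ℂ}, c.re = 1 + d → ∀ {x : ℝ}, (c.re - 1) / c.re ≤ x → d / 2 ≤ x := by
    intro c hc x hx
    rw [hc] at hx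
    have : d / 2 ≤ (1 + d - 1) / (1 + d) := by
      rw [div_le_div_iff₀ (by norm_num) (by linarith)]; nlinarith
    exact this.trans hx
  -- X₀
  have hX₀ : (L ↗Λ ((1 + d : ℝ) : ℂ)).re ≤ 1 / d + K₀ := DirichletZFR.re_LSeries_vonMangoldt_le hK hd0 hd1
  -- X₁
  have hX₁ : (L (↗χ * ↗Λ) c₁).re ≤ E - 1 / (d + η) := by
    have hMdisc := norm_LFunction_le_on_disc hRL hA hB hP hχ hℓ hq hγ4 hγℓ hd0 hdR
    have hdiff : DifferentiableOn ℂ χ.LFunction (ball c₁ (1 / 4)) :=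
      (DirichletCharacter.differentiable_LFunction hχ).differentiableOn
    have hzeros : ∀ a, χ.LFunction a = 0 → ‖a - c₁‖ ≤ R → a.re < c₁.re := by
      intro a ha _
      rw [hc₁re]
      have : a.re < 1 := by
        by_contra hcon
        exact DirichletCharacter.LFunction_ne_zero_of_one_le_re χ (Or.inl hχ) (not_lt.1 hcon) ha
      linarith
    have hfc : d / 2 ≤ ‖χ.LFunction c₁‖ := hlow hc₁re (DirichletZFR.norm_LFunction_ge χ hc₁1)
    obtain ⟨-, hα⟩ := neg_re_logDeriv_le (M := M) hdiff hR0 hR16 (fun z hz ↦ hMdisc z hz) hd0 hfc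
      hzeros
    have hρc : ‖ρ - c₁‖ ≤ R := by
      have e : ρ - c₁ = ((ρ.re - (1 + d) : ℝ) : ℂ) := Complex.ext (by simp [hc₁def]) (by simp [hc₁def, hγdef])
      rw [e, Complex.norm_real, Real.norm_eq_abs, abs_le]
      constructor <;> linarith
    have h := hα ρ hρ hρc (by rw [hc₁im])
    rw [hc₁re, ← hE_eq] at h
    rw [← DirichletZFR.neg_logDeriv_LFunction_eq χ hc₁1]
    have e3 : 1 + d - ρ.re = d + η := by rw [hηdef]; ring
    rw [e3] at h
    exact h
  -- X₂ and the conclusion, according as `χ² = χ₀` or not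
  have hfinish : ∀ {X₂ : ℝ}, 0 ≤ 3 * (L ↗Λ ((1 + d : ℝ) : ℂ)).re + 4 * (L (↗χ * ↗Λ) c₁).re + X₂ →
      X₂ ≤ E → False := by
    intro X₂ h341 hX₂
    have h1 := three_four_one_algebra h341 hX₀ hX₁ hX₂
    have h2 := core_ineq hd0 hη0 h1 hlt
    linarith
  by_cases hχ2 : χ ^ 2 = 1
  · -- third function `ζ(1 + d + 2iγ)`
    have h341 := DirichletZFR.three_four_one_quadratic χ hχ2 hσ γ
    rw [e₂] at h341
    refine hfinish h341 ?_
    have hMdisc := norm_zeta_le_on_disc hRζ hA hB hP hℓ hLq0 hq h2γ4 h2γℓ hd0 hdR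
    have hdiff : DifferentiableOn ℂ riemannZeta (ball c₂ (1 / 4)) :=
      differentiableOn_zeta_ball (by rw [hc₂im]; linarith)
    have hzeros : ∀ a, riemannZeta a = 0 → ‖a - c₂‖ ≤ R → a.re < c₂.re := by
      intro a ha _
      rw [hc₂re]
      have : a.re < 1 := by
        by_contra hcon
        exact riemannZeta_ne_zero_of_one_le_re (not_lt.1 hcon) ha
      linarith
    have hfc : d / 2 ≤ ‖riemannZeta c₂‖ :=
      hlow hc₂re (ZetaClassicalRegion.norm_riemannZeta_ge_of_one_lt_re hc₂1)
    obtain ⟨hα, -⟩ := neg_re_logDeriv_le (M := M) hdiff hR0 hR16 (fun z hz ↦ hMdisc z hz) hd0 hfc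
      hzeros
    rw [← hE_eq] at hα
    rw [ArithmeticFunction.LSeries_vonMangoldt_eq_deriv_riemannZeta_div hc₂1, neg_div]
    exact hα
  · -- third function `L(1 + d + 2iγ, χ²)`
    have h341 := DirichletZFR.three_four_one χ hσ γ
    rw [e₂] at h341
    refine hfinish h341 ?_
    have hMdisc := norm_LFunction_le_on_disc hRL hA hB hP hχ2 hℓ hq h2γ4 h2γℓ hd0 hdR
    have hdiff : DifferentiableOn ℂ (χ ^ 2).LFunction (ball c₂ (1 / 4)) :=
      (DirichletCharacter.differentiable_LFunction hχ2).differentiableOn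
    have hzeros : ∀ a, (χ ^ 2).LFunction a = 0 → ‖a - c₂‖ ≤ R → a.re < c₂.re := by
      intro a ha _
      rw [hc₂re]
      have : a.re < 1 := by
        by_contra hcon
        exact DirichletCharacter.LFunction_ne_zero_of_one_le_re (χ ^ 2) (Or.inl hχ2) (not_lt.1 hcon) ha
      linarith
    have hfc : d / 2 ≤ ‖(χ ^ 2).LFunction c₂‖ :=
      hlow hc₂re (DirichletZFR.norm_LFunction_ge (χ ^ 2) hc₂1)
    obtain ⟨hα, -⟩ := neg_re_logDeriv_le (M := M) hdiff hR0 hR16 (fun z hz ↦ hMdisc z hz) hd0 hfc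
      hzeros
    rw [← hE_eq] at hα
    rw [← DirichletZFR.neg_logDeriv_LFunction_eq (χ ^ 2) hc₂1]
    exact hα

/-! ### A zero of `ζ(s)` -/

/-- **A zero `β + iγ` of `ζ` with `|γ| ≥ 21` has `1 − β ≥ d/8 = 1/(128 W² Y)`**, `Y = Y(log|γ|)`:
the same argument with the three functions `ζ(1 + d)`, `ζ(1 + d + iγ)`, `ζ(1 + d + 2iγ)`
(MV Lemma 6.5 for `∑ Λ(n) n^{-s}`), i.e. Titchmarsh's Theorem 3.10 with `θ(t) = (log log t/log t)^{2/3}`,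
`φ(t) ≍ log log t`. [cite: Titchmarsh1986, Theorem 3.10 (proof) and §6.19] -/
theorem one_sub_re_ge_zeta {A B P K₀ : ℝ} (hRζ : RichertTypeBound A B P) (hA : 1 ≤ A)
    (hB : 0 ≤ B) (hP : 0 ≤ P) (hK₀ : 0 ≤ K₀)
    (hK : ∀ σ : ℝ, 1 < σ → σ ≤ 2 → Summable (fun n : ℕ ↦ Λ n / (n : ℝ) ^ σ) ∧
      ∑' n : ℕ, Λ n / (n : ℝ) ^ σ ≤ 1 / (σ - 1) + K₀)
    {ρ : ℂ} (hρ : riemannZeta ρ = 0) (hγ : 21 ≤ |ρ.im|) :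
    dd A B P K₀ (Real.log |ρ.im|) 0 / 8 ≤ 1 - ρ.re := by
  set γ : ℝ := ρ.im with hγdef
  set ℓ : ℝ := Real.log |γ| with hℓdef
  have hℓ : 3 ≤ ℓ := three_le_log_of_ge hγ
  have hℓ0 : (0 : ℝ) ≤ ℓ := by linarith
  obtain ⟨hW, hd0, h2dR, hd1, hM0, hdec⟩ := const_facts hA hB hP hK₀ hℓ le_rfl hℓ0
  obtain ⟨hR0, hR16, -, -⟩ := Rr_facts hℓ le_rfl hℓ0
  set d := dd A B P K₀ ℓ 0 with hddef
  set R := Rr ℓ 0 with hRdef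
  set M := Mm A B P ℓ with hMdef
  set E := EE A B P K₀ ℓ 0 with hEdef
  have hE_eq : E = 8 * (Real.log (2 * M / d) + 1) / R := by rw [hEdef, EE]
  have hdR : d ≤ R := by linarith
  have hβ1 : ρ.re < 1 := by
    by_contra hcon
    exact riemannZeta_ne_zero_of_one_le_re (not_lt.1 hcon) hρ
  by_contra hlt
  rw [not_le] at hlt
  set η : ℝ := 1 - ρ.re with hηdef
  have hη0 : 0 < η := by rw [hηdef]; linarith
  have hγ0 : 0 < |γ| := by linarith
  have hγ4 : 4 ≤ |γ| := by linarith
  have h2γ4 : 4 ≤ |2 * γ| := by rw [abs_mul, abs_two]; linarith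
  have hγℓ : Real.log |γ| ≤ ℓ + 1 := by rw [hℓdef]; linarith
  have hlog2 : Real.log 2 ≤ 1 := by have := Real.log_two_lt_d9; linarith
  have h2γℓ : Real.log |2 * γ| ≤ ℓ + 1 := by
    rw [abs_mul, abs_two, Real.log_mul (by norm_num) hγ0.ne', hℓdef]; linarith
  have hσ : 1 < 1 + d := by linarith
  set c₁ : ℂ := ((1 + d : ℝ) : ℂ) + (γ : ℂ) * I with hc₁def
  set c₂ : ℂ := ((1 + d : ℝ) : ℂ) + ((2 * γ : ℝ) : ℂ) * I with hc₂def
  have hc₁re : c₁.re = 1 + d := by simp [hc₁def]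
  have hc₁im : c₁.im = γ := by simp [hc₁def]
  have hc₂re : c₂.re = 1 + d := by simp [hc₂def]
  have hc₂im : c₂.im = 2 * γ := by simp [hc₂def]
  have hc₁1 : 1 < c₁.re := by rw [hc₁re]; exact hσ
  have hc₂1 : 1 < c₂.re := by rw [hc₂re]; exact hσ
  have e₂ : ((1 + d : ℝ) : ℂ) + 2 * (γ : ℂ) * I = c₂ := by
    rw [hc₂def]; push_cast; ring
  have hlow : ∀ {c : ℂ}, c.re = 1 + d → ∀ {x : ℝ}, (c.re - 1) / c.re ≤ x → d / 2 ≤ x := by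
    intro c hc x hx
    rw [hc] at hx
    have : d / 2 ≤ (1 + d - 1) / (1 + d) := by
      rw [div_le_div_iff₀ (by norm_num) (by linarith)]; nlinarith
    exact this.trans hx
  have hzerosζ : ∀ {c : ℂ}, c.re = 1 + d → ∀ a, riemannZeta a = 0 → ‖a - c‖ ≤ R → a.re < c.re := by
    intro c hc a ha _
    rw [hc]
    have : a.re < 1 := by
      by_contra hcon
      exact riemannZeta_ne_zero_of_one_le_re (not_lt.1 hcon) ha
    linarith
  -- X₀
  have hX₀ : (L ↗Λ ((1 + d : ℝ) : ℂ)).re ≤ 1 / d + K₀ := DirichletZFR.re_LSeries_vonMangoldt_le hK hd0 hd1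
  -- X₁
  have hX₁ : (L ↗Λ c₁).re ≤ E - 1 / (d + η) := by
    have hMdisc := norm_zeta_le_on_disc hRζ hA hB hP hℓ le_rfl hℓ0 hγ4 hγℓ hd0 hdR
    have hdiff : DifferentiableOn ℂ riemannZeta (ball c₁ (1 / 4)) :=
      differentiableOn_zeta_ball (by rw [hc₁im]; linarith)
    have hfc : d / 2 ≤ ‖riemannZeta c₁‖ :=
      hlow hc₁re (ZetaClassicalRegion.norm_riemannZeta_ge_of_one_lt_re hc₁1)
    obtain ⟨-, hα⟩ := neg_re_logDeriv_le (M := M) hdiff hR0 hR16 (fun z hz ↦ hMdisc z hz) hd0 hfc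
      (hzerosζ hc₁re)
    have hρc : ‖ρ - c₁‖ ≤ R := by
      have e : ρ - c₁ = ((ρ.re - (1 + d) : ℝ) : ℂ) :=
        Complex.ext (by simp [hc₁def]) (by simp [hc₁def, hγdef])
      rw [e, Complex.norm_real, Real.norm_eq_abs, abs_le]
      constructor <;> linarith
    have h := hα ρ hρ hρc (by rw [hc₁im])
    rw [hc₁re, ← hE_eq] at h
    rw [ArithmeticFunction.LSeries_vonMangoldt_eq_deriv_riemannZeta_div hc₁1, neg_div]
    have e3 : 1 + d - ρ.re = d + η := by rw [hηdef]; ring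
    rw [e3] at h
    exact h
  -- X₂
  have hX₂ : (L ↗Λ c₂).re ≤ E := by
    have hMdisc := norm_zeta_le_on_disc hRζ hA hB hP hℓ le_rfl hℓ0 h2γ4 h2γℓ hd0 hdR
    have hdiff : DifferentiableOn ℂ riemannZeta (ball c₂ (1 / 4)) :=
      differentiableOn_zeta_ball (by rw [hc₂im]; linarith)
    have hfc : d / 2 ≤ ‖riemannZeta c₂‖ :=
      hlow hc₂re (ZetaClassicalRegion.norm_riemannZeta_ge_of_one_lt_re hc₂1)
    obtain ⟨hα, -⟩ := neg_re_logDeriv_le (M := M) hdiff hR0 hR16 (fun z hz ↦ hMdisc z hz) hd0 hfc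
      (hzerosζ hc₂re)
    rw [← hE_eq] at hα
    rw [ArithmeticFunction.LSeries_vonMangoldt_eq_deriv_riemannZeta_div hc₂1, neg_div]
    exact hα
  -- `3-4-1` for `∑ Λ(n) n^{-s}` (MV Lemma 6.5)
  have h341 := @ClassicalZFRData.three_four_one (fun n ↦ (Λ n : ℝ))
    (fun n ↦ ArithmeticFunction.vonMangoldt_nonneg)
    (fun s hs ↦ ArithmeticFunction.LSeriesSummable_vonMangoldt hs) (1 + d) hσ γ
  rw [e₂] at h341
  have h1 := three_four_one_algebra h341 hX₀ hX₁ hX₂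
  have h2 := core_ineq hd0 hη0 h1 hlt
  linarith

/-! ### Assembly: the Vinogradov–Korobov region -/

/-- Euler factors do not vanish in `Re s > 0`: `1 − p^{-s} ≠ 0` (`p ≥ 2`). [folklore] -/
theorem one_sub_prime_cpow_ne_zero {p : ℕ} (hp : 2 ≤ p) {s : ℂ} (hs : 0 < s.re) :
    1 - (p : ℂ) ^ (-s) ≠ 0 := by
  intro h
  have h1 : (p : ℂ) ^ (-s) = 1 := by linear_combination -h
  have h2 : ‖(p : ℂ) ^ (-s)‖ = 1 := by rw [h1, norm_one]
  rw [Complex.norm_natCast_cpow_of_pos (by omega), Complex.neg_re] at h2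
  have hp1 : (1 : ℝ) < p := by exact_mod_cast hp
  have : (p : ℝ) ^ (-s.re) < 1 := Real.rpow_lt_one_of_one_lt_of_neg hp1 (by linarith)
  linarith

/-- `log(|t| + 4) ≤ log|t| + 1` for `|t| ≥ 4`. [folklore] -/
theorem log_abs_add_four_le {t : ℝ} (ht : 4 ≤ |t|) : Real.log (|t| + 4) ≤ Real.log |t| + 1 := by
  have ht0 : 0 < |t| := by linarith
  have hlog2 : Real.log 2 ≤ 1 := by have := Real.log_two_lt_d9; linarith
  calc Real.log (|t| + 4) ≤ Real.log (2 * |t|) := Real.log_le_log (by linarith) (by linarith)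
    _ = Real.log 2 + Real.log |t| := Real.log_mul (by norm_num) ht0.ne'
    _ ≤ Real.log |t| + 1 := by linarith

/-- **The Vinogradov–Korobov zero-free region for `ζ` from a Richert-type bound** (Titchmarsh,
Theorem 3.10 applied as in §6.19, inexplicit constant; any power `P ≥ 0` of the logarithm): if
`|ζ(σ + it)| ≤ A|t|^{B(1−σ)^{3/2}}(log|t|)^{P}` for `|t| ≥ 3`, `1/2 ≤ σ ≤ 1`, then there is `c > 0`
with `ζ(σ + it) ≠ 0` for `|t| ≥ 21` and `σ ≥ 1 − c/((log|t|)^{2/3}(log log|t|)^{1/3})`.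
[cite: Titchmarsh1986, Theorem 3.10 and §6.19] -/
theorem zeta_zeroFree_of_richertType {A B P : ℝ} (hRζ : RichertTypeBound A B P) (hP : 0 ≤ P) :
    ∃ c : ℝ, 0 < c ∧ ∀ s : ℂ, 21 ≤ |s.im| →
      1 - c / (Real.log |s.im| ^ (2 / 3 : ℝ) * Real.log (Real.log |s.im|) ^ (1 / 3 : ℝ)) ≤ s.re →
        riemannZeta s ≠ 0 := by
  obtain ⟨K₀, hK₀, hK, -⟩ := DirichletZFR.exists_norm_logDeriv_le
  have hRζ' := richertType_max hRζ
  set A' := max A 1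
  set B' := max B 0
  have hA : 1 ≤ A' := le_max_right _ _
  have hB : 0 ≤ B' := le_max_right _ _
  set W := Wc A' B' P K₀ with hWdef
  have hW0 : 0 < W := by
    have h2 : 0 < (2 : ℝ) ^ (P + 1) * A' := by
      have : 0 < (2 : ℝ) ^ (P + 1) := Real.rpow_pos_of_pos (by norm_num) _
      nlinarith
    have hlogA : 0 ≤ Real.log (2 ^ (P + 1) * A' + 42) := Real.log_nonneg (by linarith)
    rw [hWdef, Wc]; nlinarith
  refine ⟨1 / (256 * W ^ 2), by positivity, fun s hs hre hzero ↦ ?_⟩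
  have h := one_sub_re_ge_zeta hRζ' hA hB hP hK₀ hK hzero hs
  set ℓ := Real.log |s.im| with hℓdef
  have hℓ : 3 ≤ ℓ := three_le_log_of_ge hs
  obtain ⟨hY0, -, -, -⟩ := Yv_facts hℓ
  have hd : dd A' B' P K₀ ℓ 0 / 8 = 1 / (128 * W ^ 2) / Yv ℓ := by
    rw [dd, calL, ← hWdef]; field_simp; ring
  rw [hd] at h
  change 1 - 1 / (256 * W ^ 2) / Yv ℓ ≤ s.re at hre
  have h1 : 1 / (256 * W ^ 2) / Yv ℓ < 1 / (128 * W ^ 2) / Yv ℓ := by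
    rw [div_lt_div_iff_of_pos_right hY0, div_lt_div_iff₀ (by positivity) (by positivity)]
    nlinarith
  linarith

/-- **The Vinogradov–Korobov zero-free region for `ζ` from a Richert-type bound** (Titchmarsh,
Theorem 3.10 applied as in §6.19 with Richert's (6.19.2), inexplicit constant): if
`|ζ(σ + it)| ≤ A|t|^{B(1−σ)^{3/2}}(log|t|)^{2/3}` for `|t| ≥ 3`, `1/2 ≤ σ ≤ 1` (`RichertBound A B`), then
there is `c > 0` with `ζ(σ + it) ≠ 0` for `|t| ≥ 21` and `σ ≥ 1 − c/((log|t|)^{2/3}(log log|t|)^{1/3})`.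
[cite: Titchmarsh1986, Theorem 3.10 and §6.19] -/
theorem zeta_zeroFree_of_richertBound {A B : ℝ} (hRζ : RichertBound A B) :
    ∃ c : ℝ, 0 < c ∧ ∀ s : ℂ, 21 ≤ |s.im| →
      1 - c / (Real.log |s.im| ^ (2 / 3 : ℝ) * Real.log (Real.log |s.im|) ^ (1 / 3 : ℝ)) ≤ s.re →
        riemannZeta s ≠ 0 :=
  zeta_zeroFree_of_richertType (richertTypeBound_of_richertBound hRζ) (by norm_num)

/-- **The Vinogradov–Korobov zero-free region for Dirichlet `L`-functions from Richert-type bounds**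
(Khale 2024, (1.4) = Montgomery, *Ten lectures*, p. 176, with an inexplicit constant; Khale's
Appendix B proves it by the same route with explicit constants).  Assume `RichertBound A B` for `ζ`
and `RichertBoundL A B` for the non-principal `L(s, χ)`.  Then there is `c > 0` such that for all
`q ≥ 3`, all `χ` mod `q` and `|t| ≥ 21`:
`L(σ + it, χ) ≠ 0` for `σ ≥ 1 − c/(log q + (log|t|)^{2/3}(log log|t|)^{1/3})`.
Cases: `χ = χ₀` — `L(s, χ₀) = ζ(s)∏_{p ∣ q}(1 − p^{-s})` and `one_sub_re_ge_zeta`; `χ ≠ χ₀` and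
`log q ≤ log|t|` — `one_sub_re_ge_L`; `χ ≠ χ₀` and `log q > log|t|` — the classical region
(MV Theorem 11.3, `DirichletZFR.exists_zeroFree`; `log q + log(|t| + 4) ≤ 3 log q`, and `t ≠ 0` rules
out the exceptional real zero). [cite: Khale2024, (1.4) and Theorem B.1]
[cite: MontgomeryVaughan2007, Theorem 11.3] -/
theorem vk_region_of_richertType {A B P : ℝ} (hRζ : RichertTypeBound A B P)
    (hRL : RichertTypeBoundL A B P) (hP : 0 ≤ P) :
    ∃ c : ℝ, 0 < c ∧ ∀ (q : ℕ) [NeZero q], 3 ≤ q → ∀ (χ : DirichletCharacter ℂ q) (s : ℂ),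
      21 ≤ |s.im| →
        1 - c / (Real.log q +
            Real.log |s.im| ^ (2 / 3 : ℝ) * Real.log (Real.log |s.im|) ^ (1 / 3 : ℝ)) ≤ s.re →
          χ.LFunction s ≠ 0 := by
  obtain ⟨K₀, hK₀, hK, -⟩ := DirichletZFR.exists_norm_logDeriv_le
  obtain ⟨c₁, hc₁, hzf⟩ := DirichletZFR.exists_zeroFree
  have hRζ' := richertType_max hRζ
  have hRL' := richertTypeL_max hRL
  set A' := max A 1 with hA'
  set B' := max B 0 with hB'
  have hA : 1 ≤ A' := le_max_right _ _
  have hB : 0 ≤ B' := le_max_right _ _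
  set W := Wc A' B' P K₀ with hWdef
  have hW : 6400 ≤ W := by
    have h2 : 0 < (2 : ℝ) ^ (P + 1) * A' := by
      have : 0 < (2 : ℝ) ^ (P + 1) := Real.rpow_pos_of_pos (by norm_num) _
      nlinarith
    have hlogA : 0 ≤ Real.log (2 ^ (P + 1) * A' + 42) := Real.log_nonneg (by linarith)
    rw [hWdef, Wc]; nlinarith
  have hW0 : 0 < W := by linarith
  refine ⟨min (1 / (256 * W ^ 2)) (c₁ / 4), lt_min (by positivity) (by positivity),
    fun q _ hq3 χ s hs hre hzero ↦ ?_⟩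
  set c := min (1 / (256 * W ^ 2)) (c₁ / 4) with hcdef
  have hcW : c ≤ 1 / (256 * W ^ 2) := min_le_left _ _
  have hcc₁ : c ≤ c₁ / 4 := min_le_right _ _
  have hc0 : 0 < c := lt_min (by positivity) (by positivity)
  have hc1 : c ≤ 1 / 256 := hcW.trans (by
    rw [div_le_div_iff₀ (by positivity) (by norm_num)]
    nlinarith)
  set ℓ := Real.log |s.im| with hℓdef
  have hℓ : 3 ≤ ℓ := three_le_log_of_ge hs
  obtain ⟨hY0, hlamY, hYℓ, -⟩ := Yv_facts hℓ
  have hlam1 := one_le_log hℓ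
  have hlogq0 : 0 ≤ Real.log (q : ℝ) := Real.log_natCast_nonneg q
  have hlogq1 : 1 ≤ Real.log (q : ℝ) := one_le_log (by exact_mod_cast hq3)
  change 1 - c / (Real.log q + Yv ℓ) ≤ s.re at hre
  set D := Real.log q + Yv ℓ with hDdef
  have hD1 : 1 ≤ D := by rw [hDdef]; linarith
  have hD0 : 0 < D := by linarith
  have hsre : 0 < s.re := by
    have : c / D ≤ c := div_le_self hc0.le hD1
    linarith
  have him : s.im ≠ 0 := by intro h0; rw [h0] at hs; simp at hs; linarith
  have hs1 : s ≠ 1 := by intro h; rw [h] at him; simp at him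
  -- the key comparison `c/D < (1/(128 W²))/D`
  have hkey : c / D < 1 / (128 * W ^ 2) / D := by
    rw [div_lt_div_iff_of_pos_right hD0]
    refine hcW.trans_lt ?_
    rw [div_lt_div_iff₀ (by positivity) (by positivity)]
    nlinarith
  by_cases hχ : χ = 1
  · -- principal character: through `ζ`
    subst hχ
    rw [show (1 : DirichletCharacter ℂ q).LFunction = DirichletCharacter.LFunctionTrivChar q from rfl,
      DirichletCharacter.LFunctionTrivChar_eq_mul_riemannZeta hs1] at hzero
    rcases mul_eq_zero.1 hzero with hprod | hζ
    · obtain ⟨p, hp, hp0⟩ := Finset.prod_eq_zero_iff.1 hprod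
      exact one_sub_prime_cpow_ne_zero (Nat.prime_of_mem_primeFactors hp).two_le hsre hp0
    · have h := one_sub_re_ge_zeta hRζ' hA hB hP hK₀ hK hζ hs
      have hd : dd A' B' P K₀ ℓ 0 / 8 = 1 / (128 * W ^ 2) / Yv ℓ := by
        rw [dd, calL, ← hWdef]; field_simp; ring
      rw [hd] at h
      have h2 : c / D ≤ c / Yv ℓ := div_le_div_of_nonneg_left hc0.le hY0 (by rw [hDdef]; linarith)
      have h3 : c / Yv ℓ < 1 / (128 * W ^ 2) / Yv ℓ := by
        rw [div_lt_div_iff_of_pos_right hY0]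
        refine hcW.trans_lt ?_
        rw [div_lt_div_iff₀ (by positivity) (by positivity)]
        nlinarith
      linarith
  · rcases le_or_gt (Real.log q) ℓ with hqℓ | hqℓ
    · -- `t`-dominant regime
      have h := one_sub_re_ge_L hRζ' hRL' hA hB hP hK₀ hK hχ hzero hs hqℓ
      have hd : dd A' B' P K₀ ℓ (Real.log q) / 8 = 1 / (128 * W ^ 2) / D := by
        rw [dd, calL, ← hWdef, hDdef]; field_simp; ring
      rw [hd] at h
      linarith
    · -- `q`-dominant regime: the classical region
      have hnot : ¬ (1 - c₁ / (Real.log q + Real.log (|s.im| + 4)) < s.re) :=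
        fun h' ↦ him (hzf q χ hχ s hzero h').2
      rw [not_lt] at hnot
      have hℓ4 : Real.log (|s.im| + 4) ≤ ℓ + 1 := log_abs_add_four_le (by linarith)
      have hE0 : 0 < Real.log q + Real.log (|s.im| + 4) := DirichletZFR.ell_pos q s.im
      have hE3 : Real.log q + Real.log (|s.im| + 4) ≤ 3 * D := by
        rw [hDdef]; nlinarith
      have h1 : c₁ / (3 * D) ≤ c₁ / (Real.log q + Real.log (|s.im| + 4)) :=
        div_le_div_of_nonneg_left hc₁.le hE0 hE3
      have h2 : c / D < c₁ / (3 * D) := by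
        rw [div_lt_div_iff₀ hD0 (by positivity)]
        nlinarith
      linarith

/-- **The Vinogradov–Korobov zero-free region for Dirichlet `L`-functions from the Richert-type
bounds with `P = 2/3`** (`RichertBound`, `RichertBoundL`; Khale (1.4) / Montgomery with an
inexplicit constant): the case `P = 2/3` of `vk_region_of_richertType`.
[cite: Khale2024, (1.4) and Theorem B.1] [cite: MontgomeryVaughan2007, Theorem 11.3] -/
theorem vk_region_of_richert {A B : ℝ} (hRζ : RichertBound A B) (hRL : RichertBoundL A B) :
    ∃ c : ℝ, 0 < c ∧ ∀ (q : ℕ) [NeZero q], 3 ≤ q → ∀ (χ : DirichletCharacter ℂ q) (s : ℂ),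
      21 ≤ |s.im| →
        1 - c / (Real.log q +
            Real.log |s.im| ^ (2 / 3 : ℝ) * Real.log (Real.log |s.im|) ^ (1 / 3 : ℝ)) ≤ s.re →
          χ.LFunction s ≠ 0 :=
  vk_region_of_richertType (richertTypeBound_of_richertBound hRζ)
    (richertTypeBoundL_of_richertBoundL hRL) (by norm_num)

end VKFromRichert

open VKFromRichert in
/-- `vk_region_of_richertType` in the interface form of `VinogradovKorobovDirichlet.lean`:
**`RichertTypeBound A B P → RichertTypeBoundL A B P → 0 ≤ P → ∃ c > 0, HasVKZeroFreeRegion c 21`.**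
[cite: Khale2024, (1.4) and Theorem B.1] -/
theorem hasVKZeroFreeRegion_of_richertType {A B P : ℝ} (hRζ : RichertTypeBound A B P)
    (hRL : RichertTypeBoundL A B P) (hP : 0 ≤ P) : ∃ c : ℝ, 0 < c ∧ HasVKZeroFreeRegion c 21 :=
  vk_region_of_richertType hRζ hRL hP

open VKFromRichert in
/-- `vk_region_of_richert` in the interface form of `VinogradovKorobovDirichlet.lean`:
**`RichertBound A B → RichertBoundL A B → ∃ c > 0, HasVKZeroFreeRegion c 21`.**
[cite: Khale2024, (1.4) and Theorem B.1] -/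
theorem hasVKZeroFreeRegion_of_richert {A B : ℝ} (hRζ : RichertBound A B) (hRL : RichertBoundL A B) :
    ∃ c : ℝ, 0 < c ∧ HasVKZeroFreeRegion c 21 :=
  vk_region_of_richert hRζ hRL

open VKFromRichert in
/-- **The inexplicit Vinogradov–Korobov region for `ζ` from Ford's Theorem 1** (`zeta_bound_ford`,
`|ζ(σ + it)| ≤ 76.2 t^{4.45(1−σ)^{3/2}} log^{2/3} t`): `∃ c > 0`, `ζ(σ + it) ≠ 0` for `|t| ≥ 21`,
`σ ≥ 1 − c/((log|t|)^{2/3}(log log|t|)^{1/3})`. [cite: Ford2002, Theorem 1]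
[cite: Titchmarsh1986, Theorem 3.10 and §6.19] -/
theorem zeta_zeroFree_of_zeta_bound_ford (h : zeta_bound_ford) :
    ∃ c : ℝ, 0 < c ∧ ∀ s : ℂ, 21 ≤ |s.im| →
      1 - c / (Real.log |s.im| ^ (2 / 3 : ℝ) * Real.log (Real.log |s.im|) ^ (1 / 3 : ℝ)) ≤ s.re →
        riemannZeta s ≠ 0 :=
  zeta_zeroFree_of_richertBound (richertBound_ford h)

end Literature.NumberTheory.LFunctions
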